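/-
Copyright: lit-balaban Phase-2 proof seat p27 (gen 40).  Statement-level skeleton of a published paper; no proof claims beyond what the
kernel checks below.
-/
import Literature.MathematicalPhysics.QuantumFieldTheory.BalabanImbrieJaffe1984to88.BIJ88Eq242HiggsCovarianceTorus
import Literature.MathematicalPhysics.QuantumFieldTheory.BalabanImbrieJaffe1984to88.BIJ88Sect3Translations
import Literature.MathematicalPhysics.QuantumFieldTheory.BalabanImbrieJaffe1984to88.BIJ85TorusTentCutoff
import Literature.MathematicalPhysics.QuantumFieldTheory.BalabanImbrieJaffe1984to88.BIJ85Eq325Corrections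
import Literature.MathematicalPhysics.QuantumFieldTheory.BalabanImbrieJaffe1984to88.BIJ88ScalarTranslation330Torus
import Literature.MathematicalPhysics.QuantumFieldTheory.BalabanImbrieJaffe1984to88.BIJ88RegionTower274
import Literature.MathematicalPhysics.QuantumFieldTheory.Balaban1983to89.B3Bound323ZeroTorus

/-!
# `BalabanImbrieJaffe1984to88.BIJ88Small333ScalarField` — T. Bałaban, J. Imbrie, A. Jaffe, *Effective action and cluster properties of the
abelian Higgs model*, Commun. Math. Phys. **114** (1988) 257–315 [BalabanImbrieJaffe1988], Sect. 3 p. 270 [PDF 14]: THE SCALAR-FIELD HALF of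
(3.33) «|φ^{(0)}| ≦ cp(e₀)» for the fluctuation field of the scalar translation (3.30), PROVED on the torus of record by the print's own mechanism
(the fluctuation identity at the Dirichlet covariance `C_Λ`, its (2.41) row sums, the (2.47) swap to `C_{Λ,loc}`, a located margin) —
theorems only.  v1.1 (same seat): + §6, the transfer of (3.15) from `u` to `u₁ = u·e^{−ie₀A^{(0)}}` (p11's `BIJ85Eq325Corrections` BY
NAME); + §7, the located margin READ OFF r18's `BIJ88RegionTower274.collarShrink` (print's *"deleting r(e₀)-cubes at the boundary"*, the
torus distance of record = `supDist` by pv's `B3Bound323ZeroTorus.T_eq_supDist`); imports p29 g34's `BIJ88ScalarTranslation330Torus` (landed in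
the same commit window) and uses its `dN_univ_mulVec` BY NAME (the v1.0 copy is dropped — the only v1.0 declaration touched); that file
carries the (3.30) definitions `cLocC` / `corr330` that plug into `small333_scalar_phi330_full`

statement-level skeleton of published theorems with citation tags; proofs where landed; nothing here is a claim about the Yang–Mills mass gap

PDF held: `paper:balaban1988-cmp114-bij-abelian-higgs-effective-action` (journal page = PDF page + 256); pp. 264–265, 267, 269–270 [PDF 8–9, 11,
13–14] and p. 297 [PDF 41] read this session from the text layer (`lit read …`, files `p0008.txt`, `p0009.txt`, `p0011.txt`, `p0013.txt`, `p0014.txt`,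
`p0041.txt`).

CITATION HEADER (lean-in-tree rule).  Part of the lit-balaban TYPED SKELETON (HOME `run/shared/lean/pub/lit-balaban/`), Phase 2, seat p27
GEN 40 (unit `lit-balaban-p27`; free-target protocol G.5-34(d): TAKING line HOME/STATUS.md 2026-08-23T12:43:19Z; owner r18 g27 «NO OBJECTION —
WELCOME» 12:44:50Z; disjoint complement of p29 g34's TAKING 12:41:16Z `BIJ88ScalarTranslation330Torus` = the (3.30) DEFINITIONS `cloc0` /
`corr330` / `op331`, which this file does not restate: every statement here is over CLOSED tree expressions and ANY kernel `K_loc` equal to the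
complex packaging of p13's local walk sum; p29's file landed in the same commit window (p365669) and its `corr330`/`cLocC` plug into
`small333_scalar_phi330_full` by `cLocC_of_not_mem_right` / `cLocC_of_mem` / `rfl` — the by-name corollary is p29's companion
`BIJ88ScalarTranslation330Size`, by agreement 13:21Z/13:31Z); row **C2.Eq3.33** (member: the `φ^{(0)}`
clause of r18's `BIJ88Sect3Statements.Small333`; the `A^{(0)}` clause is this seat's gen-39 `BIJ88Small333GaugeField.small333_gauge`, p364385)
and cells of C2.Eq3.30 / C2.Eq2.41 / C2.Eq2.47 of `HOME/lit-balaban-r18/ROWS-C2.md` (C2 §§1–4 fold owner r18, referee ref-5).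

THE PRINTED TEXT (verbatim).  p. 270 [PDF 14]: *"The next step is a scalar field translation to remove the term linear in φ in (3.29). Again
we make a local translation, φ = φ^{(0)} + aL^{−2}Λ₇^{(0)}C^{(0)}_{loc}(u₁)Q*(u₁)ψ. (3.30) … In the small field region Λ₀^{(0)} we have small block
fields: |v(p) − 1| ≦ ce₀p(e₀), |ψ(y)| ≦ cp(e₀)λ₀^{−1/4}, |(D_{ū₁}ψ)(b′)| ≦ cp(e₀), b′ ∈ Λ₀^{(0)′*} (3.32) … Similarly, it can be shown that
|A^{(0)}| ≦ cp(e₀) in Λ₁^{(0)*}, |φ^{(0)}| ≦ cp(e₀) in Λ₁^{(0)*}, (3.33) and we inset a factor χ′_{Λ₇^{(0)}} enforcing these bounds in Λ₇^{(0)}."*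
p. 267 [PDF 11], (3.15): *"Here Λ₀^{(0)} ⊂ T₁ is the small field region. It is composed of r(e₀)-cubes, in each of which the factor χ_{Λ₀^{(0)}}
enforces the following conditions: |D_uφ| ≦ p(e₀), |ψ − Q(u)φ| ≦ p(e₀), |φ| ≦ λ₀^{−1/4}p(e₀), |f^{(0)}(p)| ≦ p(e₀)"*; *"Later in this step we will
introduce sets Λ₁^{(0)}, Λ₂^{(0)}, etc., which are obtained from Λ₀^{(0)} either by deleting r(e₀)-cubes at the boundary of Λ₀^{(0)}, or …"*.
THE MECHANISM is printed for the general step, p. 297 [PDF 41]: *"We want a similar bound for φ^{(k)}(x), x ∈ Λ₇^{(k)}. Note that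
C^{(k)}_{loc}(u_{k+1}) is almost equal to C^{(k)}(u_{k+1}). Thus we have that in Λ₇^{(k)}, say |φ − a_kL^{−2}C^{(k)}_{loc}(u_{k+1})Q(u_{k+1})*ψ| ≦
O(p(e_k)) (the corresponding statement with C^{(k)}(u_{k+1}) was proven in [8, Eq. (2.113)]. Using arguments like the ones we used to bound
D_{ū_{k+1}}ψ, we can replace Q(u_{k+1})*ψ with φ in this bound. This proves that |φ^{(k)}(x)| ≦ cp(e_k), x ∈ Λ₇^{(k)}. (5.9.5)"* ([8] =
[Balaban1982Higgs2] Lemma 2.7 / (2.113)–(2.114) p. 581, typed by p23 as `Balaban1983to89.B2Ineq2114Proof`); pp. 264–265 [PDF 8–9]: *"We define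
C^{(k)}_Λ(u) = [(Δ_{k,loc}(u) + aL^{−2}Q(u)*Q(u))|_Λ]^{−1}. (2.40) … |C^{(k)}_Λ(u; x₁, x₂)| ≦ ce^{−c|x₁−x₂|}. (2.41) … C^{(k)}_{Λ,loc}(u; x₁, x₂) =
Σ′_ω C^{(k)}_{Λ,ω}(x₁, x₂), (2.43)"* [p. 264] *"… |C^{(k)}_{Λ,loc}(u; x₁, x₂) − C^{(k)}_Λ(u; x₁, x₂)| ≦ e^{−cr(e_k)}e^{−c|x₁−x₂|}. (2.47)"* [p. 265, PDF 9].
A READING, not a printed sentence (v1.1 docfix, referee ref-5 D-g74-3): at `k = 0` the operator `Δ_{k,loc}(u)` of (2.40) is taken to be the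
covariant Laplacian `−Δ_{u₁}` of the printed first-step form (3.31) «−Δ_{u₁} + aL^{−2}Q(u₁)*Q(u₁)» (p. 270); p. 269 itself says only *"In the
general step, a gauge transformation is needed at this point. However, it is unnecessary here."* (text layer `p0013.txt` L19–20).

THE OBJECTS (all OF RECORD, consumed BY NAME; tori of `Balaban1983to89.Setup`: unit lattice `T₁ = T^{(j)}` (sites, bonds `PBond P j`), block
lattice `T^{(j+1)}`; `d = P.d`, block side `P.L`):
* `H = D_{u₁}^*D_{u₁} + κQ(u₁)ᴴQ(u₁)` = p31's `BIJ88NeumannPropagator227Torus.nOp κ c U₁ 1 univ` on the whole unit torus (`nOp_eq`; its pieces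
  `dN c U₁ univ` = the matrix of r18's covariant derivative `covD c (cfg U₁)`, and `qMatT U₁ 1` = gen 15's matrix of the covariant block
  average, `qMatT_apply`: `(Q(u)φ)(y) = L^{−d}Σ_{x∈B(y)}u(Γ_{yx})φ(x)`); print's `−Δ_{u₁} + aL^{−2}Q(u₁)^*Q(u₁)` of (3.31) read with `κ = aL^{−2}`
  and the adjoint `Q* = Qᴴ` of the tree's uniform weights (r18's `scalarForms`, p31, r18 g27's (3.31) instance) — at which (3.30) with `C`
  for `C_{loc}` and no `Λ₇` is exactly the completing-the-square shift of (3.29) (p02's `BIJ88BasicForms331.eq331` on the End carrier);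
* `C_Λ = (H|_Λ)^{−1}` = `(BIJ88Eq240FlatTorus.compress Λ H)⁻¹`, the Dirichlet covariance (2.40) at `k = 0` on a region `Λ` (finset of sites);
* `C_{Λ,loc}` (2.43) = p13's primed walk sum `BIJ88RandomWalk242.cLoc` (radius `ρ`, print `¼r(e₀)`) with p13's walk terms
  `BIJ88Eq242Lattice.latticeCw` on p31's charted realified operator `BIJ88Eq242HiggsCovarianceTorus.reOp Λ H`, PACKAGED AS THE COMPLEX KERNEL
  `K_loc(x₁,x₂) = C_loc((x₁,Re),(x₂,Re)) + i·C_loc((x₁,Im),(x₂,Re))` (p31's convention of `hasSum_walkTerms_inv`); the theorems quantify over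
  ANY `Kl : Matrix Λ Λ ℂ` equal to this packaging (hypothesis `hKl`), so p29 g34's `cloc0` (announced as this packaging, zero off `Λ`) is served by
  its unfolding, and `corr330 = cloc0 *ᵥ (Q(u₁)ᴴψ)` enters `small333_scalar_phi330` through the hypothesis `hcorr`;
* (3.30) = r18's `BIJ88Sect3Translations.phi330 Λ₇ a L φ0 corr` (`φ = φ^{(0)} + 1_{Λ₇}·aL^{−2}·corr`); (3.15) = r18's
  `BIJ88Sect3Statements.SmallField315`, (3.32) = `SmallBlock332`, (3.33) = `Small333` (its SECOND clause is what is proved, on the sites of `Λ₇`);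
* the kernel inputs at p31's abstraction of `BIJ88Eq242HiggsCovarianceTorus` §5: [6] = [Balaban1983RegularityDecay] (5.6) for the charted
  operator (`B4.Hyp56 (chartSet Λ) (reOp Λ H) γ₀ c₀ δ₀`), `IsUnit (H|_Λ)`, p13's cube-size conditions (`M ≥ 5`, `M > K_R`, `M > Θ₁`, `θ_W < 1`), under
  which `norm_inv_apply_le_walk` ((2.41), torus distance `B5Ineq137Torus.T`) and `close247_walk` ((2.47), `BIJ88Sect2Statements.Close` in the
  chart distance, which dominates the torus distance: `T_le_cdist`) hold BY NAME; the torus radial sum is p38's `B5Ineq137Torus.rowSum_T_le`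
  (`Σ_y e^{−a|x−y|_T} ≤ K_d(a)`, pv23's `B4Sect5Proof.latticeConst`).

WHAT IS PROVED (0 `sorry`, standard axioms, NO definitions, no named facts).
* §0 kernels: bonds at a site (`sum_ite_tgt_eq`, `sum_ite_src_eq`), the whole-torus covariant derivative and its adjoint pointwise
  (`dN_univ`, p29's `dN_univ_mulVec`, `conjTranspose_dN_univ_mulVec_apply`, **`norm_conjTranspose_dN_univ_mulVec_le`**: `|(D_u^*g)(x)| ≤ |c|·2d·G`),
  the adjoint block average pointwise (`conjTranspose_qMatT_mulVec_apply`, **`norm_conjTranspose_qMatT_mulVec`**: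
  `|(Q(u)ᴴχ)(x)| = L^{−d}|χ(y_x)|`, `qMatT_mulVec_eq_zero_of_forall`), **`nOp_univ_mulVec`** (`Hφ = D_u^*(D_uφ) + κQ(u)ᴴ(Q(u)φ)`), the Dirichlet
  restriction against the torus operator (`compress_mulVec_restrict_apply`: `(H|_Λφ|_Λ)(x) = (Hφ)(x) − (H(1_{Λᶜ}φ))(x)`,
  `inv_mulVec_compress_mulVec`), `norm_mulVec_apply_le`.
* §1 **`fluct_identity`** — for `x ∈ Λ`:
  **`φ(x) − κ(C_Λ(Q(u₁)ᴴψ)|_Λ)(x) = (C_Λ[(D_{u₁}^*D_{u₁}φ)|_Λ − κ(Q(u₁)ᴴ(ψ − Q(u₁)φ))|_Λ − (H(1_{Λᶜ}φ))|_Λ])(x)`** — the old field minus the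
  GLOBAL part of the (3.30) shift is the covariance applied to the two SMALL quantities of (3.15) and a boundary-layer term (this is the
  content of [8] Lemma 2.7 + (2.114) in the present model: no `λ₀^{−1/4}` survives).
* §2 sizes of the three terms: `norm_lapTerm_le` (`≤ |c|·2d·p_D` when `|D_{u₁}φ| ≤ p_D` on the bonds meeting `Λ`), `norm_qTerm_le`
  (`≤ L^{−d}p_Q` when `|ψ − Q(u₁)φ| ≤ p_Q` on the blocks of the 1-block union `Λ`), **`norm_nOp_mulVec_indicator_compl_le`** (the `∂Λ`-term is
  `≤ 2dc²Φ` when `|φ| ≤ Φ` on the outer layer of `Λ`; the `QᴴQ` part does not cross a block union) and **`nOp_mulVec_indicator_compl_eq_zero`** (it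
  VANISHES at the sites of `Λ` all of whose `2d` neighbours lie in `Λ`), `norm_qAdj_le`.
* §3 with ABSTRACT kernel constants: **`norm_fluct_le`** (global covariance: row sum `≤ K`, tail row sum beyond torus distance `R` `≤ K_R`, located
  margin «every site of `Λ` with a neighbour outside `Λ` is at distance `≥ R` from `x`» ⟹ `|φ(x) − κ(C_ΛQᴴψ)(x)| ≤ K(2d|c|p_D + κL^{−d}p_Q) +
  K_R·2dc²Φ`), **`norm_swap_le`** (any `K_loc` with `Σ_{x₂}|K_loc − C_Λ|(x,x₂) ≤ δ′` and `|ψ| ≤ Ψ` on the blocks of `Λ`: the swap costs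
  `κδ′L^{−d}Ψ`), **`norm_phi0_le_abstract`** (the sum of the two).
* §4 the constants from the walk expansion, p31/p13/p38 BY NAME: **`rowSum_inv_le_walk`** (`Σ_{x₂}|C_Λ(x,x₂)| ≤ A_wK_d(δ₀/8M)`,
  `A_w = 2·2^dγ₀^{−1}(1−θ_W)^{−1}e^{δ₀/4}`), **`tailSum_inv_le_walk`** (`Σ_{|x−x₂|_T ≥ R} ≤ A_we^{−(δ₀/16M)R}K_d(δ₀/16M)`),
  **`rowSum_cloc_sub_inv_le_walk`** ((2.47) complex, row-summed: `≤ 2δ_{247}K_d(δ₀/16M)`, `δ_{247} = 2^dγ₀^{−1}(1−θ_W)^{−1}e^{−(δ₀/16)(ρ−3)}`).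
* §5 **(3.33), SCALAR HALF**: **`small333_scalar`** (explicit constants: `|φ(x) − κ(K_locQ(u₁)ᴴψ)(x)| ≤ A_wK_d(δ₀/8M)(2d|c|p_D + κL^{−d}p_Q) +
  A_we^{−(δ₀/16M)R}K_d(δ₀/16M)·2dc²Φ + κ·2δ_{247}K_d(δ₀/16M)L^{−d}Ψ`), **`small333_scalar_of_regime`** (`≤ c·p` once `p_D, p_Q ≤ c₁p`,
  `e^{−(δ₀/16M)R}Φ ≤ p`, `δ_{247}Ψ ≤ p`), **`small333_scalar_phi330`** (r18's `phi330` read: `‖φ0 x‖ ≤ …` at `x ∈ Λ₇ ∩ Λ`, `κ = aL^{−2}`, the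
  correction `corr` agreeing on `Λ₇ ∩ Λ` with `K_locQ(u₁)ᴴψ`), **`small333_scalar_phi330_region`** (`∀ x ∈ Λ₇, ‖φ0 x‖ ≤ c·p` — the shape of the
  second conjunct of r18's `Small333 c p Λ₇ A0 φ0`), **`small333_scalar_phi330_full`** (the same for a FULL-LATTICE kernel `K` vanishing off `Λ` in its
  second argument — the shape of p29 g34's `cLocC Λ (nOp κ c U₁ 1 univ) M ρ`, with `corr = K(Q(u₁)ᴴψ)` = their `corr330` on `Λ₇`),
  **`small333_scalar_of_smallField315`** (inputs = r18's `SmallField315` AT `u₁` and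
  `SmallBlock332` on a region `Λ₀ ⊇ Λ` + one layer whose blocks contain those of `Λ`: `∀ x ∈ Λ₇, ‖φ0 x‖ ≤ c·p(e₀)` under the two regime
  inequalities `e^{−(δ₀/16M)R}λ₀^{−1/4} ≤ 1`, `δ_{247}c′λ₀^{−1/4} ≤ 1`).
* §6 (v1.1) **THE TRANSFER OF (3.15) FROM `u` TO THE BACKGROUND `u₁ = u·e^{−ie₀A^{(0)}}`** (print p. 297; (3.24)/(3.27)/(3.28): inside
  `Λ₁* ∩ Λ₄* ∩ Λ₆*`, `u = e^{ie₀A^{(0)}}u₁`; `u₁` = p11's `BIJ85Eq325Corrections.uOne u e₀ A^{(0)}`, [BalabanImbrieJaffe1985] (3.21)):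
  `blockOf_legBond`, **`norm_holC_sub_holC_uOne_le_local`** (`|u(Γ_{yx}) − u₁(Γ_{yx})| ≤ d(L−1)|e₀|M`, `|A^{(0)}| ≤ M` on the bonds INSIDE the
  block of `x` — p11's global lemma localized), **`norm_qCov_sub_qCov_uOne_le_local`** (`|(Q(u)φ)(y) − (Q(u₁)φ)(y)| ≤ d(L−1)|e₀|M·Φ`),
  `qMatT_one_mulVec`, `mem_block_iff_mem_blockK`, **`norm_covD_uOne_le`** (`|D_{u₁}φ(b)| ≤ p + |c||e₀|c_ApΦ`), **`norm_sub_qMatT_uOne_le`**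
  (`|ψ(y) − (Q(u₁)φ)(y)| ≤ p + d(L−1)|e₀|c_ApΦ`), **`small333_scalar_of_smallField315_at_u`** (inputs = r18's `SmallField315` AT `u` AS
  PRINTED + `|A^{(0)}_b| ≤ c_Ap(e₀)` on the bonds of `Λ₀` (the gauge half) + `SmallBlock332`; background `uOne u e₀ A^{(0)}` in the operator and in
  `Q(u₁)ᴴψ`; one more regime inequality `|e₀|c_Ap(e₀)λ₀^{−1/4} ≤ 1`: `∀ x ∈ Λ₇, ‖φ0 x‖ ≤ c·p(e₀)` with `c₁ = 1 + |c| + d(L−1)`).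
* §7 (v1.1) **THE LOCATED MARGIN FROM THE COLLAR**: **`margin_of_subset_collarShrink`** (`Λ₇ ⊆ collarShrink R Λ` — r18's p. 274 *"subtracting
  collar neighborhoods of width r"*, p. 267 *"deleting r(e₀)-cubes at the boundary"* — ⟹ every site of `Λ` with a lattice neighbour outside `Λ`
  is at torus distance `≥ R` from every `x ∈ Λ₇`: the margin hypothesis `hR` of §5/§6 DISCHARGED; `T = supDist` is pv's `T_eq_supDist`, one
  lattice step moves `supDist` by `≤ 1` is p16's `supDist_shift_le_succ`), **`small333_scalar_phi330_collar`** (`small333_scalar_phi330_full` on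
  `Λ₇ ⊆ collarShrink R Λ`, no pointwise margin hypothesis).
HONEST SCOPE.  (i) Only the `φ^{(0)}`-half of (3.33) is claimed here (the `A^{(0)}`-half is gen 39's file); the bound is proved AT THE SITES of a
region `Λ₇ ⊆ Λ` carrying the located margin, for the fluctuation field `φ^{(0)}(x) = φ(x) − aL^{−2}(K_locQ(u₁)ᴴψ)(x)` of r18's `phi330` with the
local correction; the print's second membership «in Λ₁^{(0)*}» [sic] is read, as r18 reads it, on the sites of the region (`Λ₇`).  (ii) THE
LOCATED INPUTS are hypotheses, verbatim the print's: (3.15)-type smallness of `D_{u₁}φ` and `ψ − Q(u₁)φ` near `Λ` — AT THE BACKGROUND `u₁`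
(print's (3.15) is at `u`; §6 DERIVES the transfer for `u₁ = u·e^{−ie₀A^{(0)}}` given `|A^{(0)}| ≤ c_Ap` on the bonds of `Λ₀` — that
`u₁` IS the p. 270 background on `Λ₁* ∩ Λ₄* ∩ Λ₆*` is (3.24)/(3.27)/(3.28) (p29's `u1bg_eq_backgroundU`), taken as the identification of the
input `U`, not re-proved here; cf. p30 g32's `BIJ88SmallBlockFields332` for the `D_{ū₁}ψ` clause of (3.32)); the `λ₀^{−1/4}p(e₀)`
bounds `Φ` (φ on the outer layer of `Λ`) and `Ψ` (ψ on the blocks of `Λ`); the margin `R` (print: `Λ₇^{(0)}` is `≥ 7` cube-deletions inside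
`Λ₀^{(0)}`; `R ~ r(e₀)`) — pointwise in §5/§6, or (§7) as the membership `Λ₇ ⊆ collarShrink R Λ` of r18's p. 274 vocabulary (which tower level
`Λ_α^{(0)}` plays `Λ` is the user's reading; print does not fix it) — and the two REGIME inequalities making `e^{−(δ₀/16M)R}` and the (2.47) defect `e^{−(δ₀/16)(ρ−3)}` beat `λ₀^{−1/4}`
(print: `r(e₀) → ∞`; not derived from a typed `r(e_k)`/`p(e_k)`/`λ_k` calculus).  (iii) THE KERNEL INPUTS are at p31's abstraction ([6] (5.6)
`Hyp56` of the charted realified `H|_Λ`, invertibility, p13's cube sizes) — NOT discharged here for `H = nOp κ c U₁ 1 univ` (p29 g34's (3.30) file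
announces that discharge at small fields on a no-wrap `Λ`: (2.38)-shape with `γ = c²`, `E = 0`, range-1 kernel); the constants are explicit and
uniform in the volume, depending on `(d, L, κ, c, γ₀, δ₀, M, ρ)`.  (iv) `C^{(0)}_{loc}` enters as ANY kernel equal to the complex packaging of p13's
`cLoc` on `reOp Λ H` (real coordinates `Λ × {Re, Im}` of gen 18's realification; the packaging takes the first column of each `2 × 2` block, as
p31 does for (2.42)); that the primed walk sum commutes with the complex structure is not needed and not claimed.  (v) `Q* = Qᴴ` (uniform
weights, as r18/p31); general `c` (print: `c = 1` on the unit lattice `T₁`), any `κ ≥ 0`; `Λ` a union of `L`-blocks (`IsBlockUnion 1`); every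
`d ≥ 1`, every torus of `Setup`, standing range not needed.  (vi) Nothing of the End-carrier dictionary `BIJ88ScalarSummary583.Ops` (p02/r16) is
touched.  Literature + Mathlib only; no Summits import.  Unit `lit-balaban-p27` (literature-prover-lit-balaban-p27-g40-0), 2026-08-23.  NOT summit
progress, continuum or Clay.
-/

open scoped BigOperators Matrix ComplexConjugate
open Finset Matrix

namespace Literature.MathematicalPhysics.QuantumFieldTheory.BalabanImbrieJaffe1984to88.BIJ88Small333ScalarField

open Literature.MathematicalPhysics.QuantumFieldTheory.Balaban1983to89
open BIJ88Sect3Statements (U1 toC cfg covD)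
open BIJ85BlockAveragesTorus BIJ85BlockAveragesTorusK
open BIJ88NeumannPropagator227Torus (nOp nOp_eq dN dN_mulVec qMatK)
open BIJ88DeltaLoc234Torus (qMatT qMatT_apply qMatT_mulVec)
open BIJ88Eq240FlatTorus (realify compress ext0 ext0_coe ext0_of_not_mem mulVec_ext0_coe)
open BIJ88Decay241FlatTorus (realify_apply_fst realify_apply_snd)
open BIJ88RandomWalk242 BIJ88Eq242Lattice BIJ88Ineq246Lattice B4Sect5CubeBounds
open BIJ88Eq242HiggsCovarianceTorus
open B4Sect5Proof (latticeConst latticeConst_nonneg)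
open BIJ85TorusTentCutoff (shift_apply_self' shift_apply_ne' unshift_apply_self' unshift_apply_ne' supDist_shift_le_succ supDist_unshift_le_succ)
open BIJ85Eq325Corrections (uOne norm_covD_sub_covD_uOne_le qCov_sub_qCov_uOne holC_eq_holC_uOne_mul)
open BIJ88RenormTransf311 (inBlock)
open BIJ88ScalarTranslation330Torus (dN_univ_mulVec)
open BIJ88RegionTower274 (collarShrink mem_collarShrink collarShrink_subset)
open B3Bound323ZeroTorus (T_eq_supDist)
open LatticeFieldCalculus (supDist)

noncomputable section

variable {P : Params} {j : ℕ}

/-! ## §0  Kernels -/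

/-- kernel: `(x − e_μ) + e_μ = x`. [folklore] -/
private theorem shift_unshift (x : Balaban1983to89.Site P j) (μ : Fin P.d) : (x.unshift μ).shift μ = x := by
  funext ν
  by_cases h : ν = μ
  · subst h; rw [shift_apply_self', unshift_apply_self', sub_add_cancel]
  · rw [shift_apply_ne' _ h, unshift_apply_ne' _ h]

/-- kernel: `(x + e_μ) − e_μ = x`. [folklore] -/
private theorem unshift_shift (x : Balaban1983to89.Site P j) (μ : Fin P.d) : (x.shift μ).unshift μ = x := by
  funext ν
  by_cases h : ν = μ
  · subst h; rw [unshift_apply_self', shift_apply_self', add_sub_cancel_right]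
  · rw [unshift_apply_ne' _ h, shift_apply_ne' _ h]

/-- kernel: a bond ends at `x` iff it is `⟨x − e_μ, μ⟩` for its direction `μ`. [folklore] -/
private theorem tgt_eq_iff (b : PBond P j) (x : Balaban1983to89.Site P j) : b.tgt = x ↔ b = ⟨x.unshift b.dir, b.dir⟩ := by
  constructor
  · intro h
    have hs : b.src = x.unshift b.dir := by rw [← h, PBond.tgt, unshift_shift]
    cases b; simp only at hs ⊢; rw [hs]
  · intro h; rw [h, PBond.tgt]; exact shift_unshift x _

/-- kernel: a bond starts at `x` iff it is `⟨x, μ⟩` for its direction `μ`. [folklore] -/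
private theorem src_eq_iff (b : PBond P j) (x : Balaban1983to89.Site P j) : b.src = x ↔ b = ⟨x, b.dir⟩ := by
  constructor
  · intro h; cases b; simp only at h ⊢; rw [h]
  · intro h; rw [h]

/-- kernel: **a sum over the bonds ending at `x` is a sum over the `d` directions** (`b = ⟨x − e_μ, μ⟩`). [folklore] -/
private theorem sum_ite_tgt_eq {α : Type*} [AddCommMonoid α] (x : Balaban1983to89.Site P j) (f : PBond P j → α) :
    ∑ b : PBond P j, (if b.tgt = x then f b else 0) = ∑ μ : Fin P.d, f ⟨x.unshift μ, μ⟩ := by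
  classical
  rw [← Finset.sum_filter]
  refine Finset.sum_bij' (fun b _ => b.dir) (fun μ _ => ⟨x.unshift μ, μ⟩) ?_ ?_ ?_ ?_ ?_
  · intro b hb; exact mem_univ _
  · intro μ _; rw [Finset.mem_filter]; exact ⟨mem_univ _, shift_unshift x μ⟩
  · intro b hb; rw [Finset.mem_filter] at hb; exact ((tgt_eq_iff b x).1 hb.2).symm
  · intro μ _; rfl
  · intro b hb; rw [Finset.mem_filter] at hb; rw [← (tgt_eq_iff b x).1 hb.2]

/-- kernel: **a sum over the bonds starting at `x` is a sum over the `d` directions** (`b = ⟨x, μ⟩`). [folklore] -/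
private theorem sum_ite_src_eq {α : Type*} [AddCommMonoid α] (x : Balaban1983to89.Site P j) (f : PBond P j → α) :
    ∑ b : PBond P j, (if b.src = x then f b else 0) = ∑ μ : Fin P.d, f ⟨x, μ⟩ := by
  classical
  rw [← Finset.sum_filter]
  refine Finset.sum_bij' (fun b _ => b.dir) (fun μ _ => ⟨x, μ⟩) ?_ ?_ ?_ ?_ ?_
  · intro b hb; exact mem_univ _
  · intro μ _; rw [Finset.mem_filter]; exact ⟨mem_univ _, rfl⟩
  · intro b hb; rw [Finset.mem_filter] at hb; exact ((src_eq_iff b x).1 hb.2).symm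
  · intro μ _; rfl
  · intro b hb; rw [Finset.mem_filter] at hb; rw [← (src_eq_iff b x).1 hb.2]


/-! ### The covariant derivative `D_u` on the whole torus and its adjoint, pointwise -/

open Classical in
/-- kernel: on the whole torus the Neumann cut-off is trivial: `χ_T D_u = D_u` (p31's `dN c U univ` is the matrix `dMat c u` of r18's `covD`).
[cite: BalabanImbrieJaffe1988, (3.3) p.265] -/
theorem dN_univ (c : ℝ) (U : GaugeField P j U1) : dN c U univ = BIJ88Vj5610Operator.dMat c (cfg U) := by
  have h : BIJ88Vj5610Operator.chiN (univ : Finset (Balaban1983to89.Site P j)) = 1 := by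
    ext b b'
    simp [BIJ88Vj5610Operator.chiN, Matrix.diagonal, BIJ88Sect3Statements.mem_starB, Matrix.one_apply]
  unfold dN
  rw [h, Matrix.one_mul]

/-- kernel: **the adjoint covariant derivative pointwise**: `(D_u^*g)(x) = c(Σ_μ \overline{u(x−e_μ, μ)}g(x−e_μ, μ) − Σ_μ g(x, μ))` — the `2d`
bonds at `x`. [cite: BalabanImbrieJaffe1988, (3.3) p.265] -/
theorem conjTranspose_dN_univ_mulVec_apply (c : ℝ) (U : GaugeField P j U1) (g : PBond P j → ℂ) (x : Balaban1983to89.Site P j) :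
    ((dN c U univ)ᴴ *ᵥ g) x =
      (c : ℂ) * (∑ μ : Fin P.d, (starRingEnd ℂ) (cfg U ⟨x.unshift μ, μ⟩) * g ⟨x.unshift μ, μ⟩ - ∑ μ : Fin P.d, g ⟨x, μ⟩) := by
  rw [dN_univ, mulVec, dotProduct]
  simp only [conjTranspose_apply, BIJ88Vj5610Operator.dMat, of_apply, star_sub, Complex.star_def, map_mul, Complex.conj_ofReal,
    apply_ite (starRingEnd ℂ), map_one, map_zero, sub_mul, Finset.sum_sub_distrib, mul_ite, mul_zero, ite_mul, zero_mul]
  have h1 : ∑ b : PBond P j, (if x = b.tgt then (c : ℂ) * (starRingEnd ℂ) (cfg U b) * g b else 0) =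
      (c : ℂ) * ∑ μ : Fin P.d, (starRingEnd ℂ) (cfg U ⟨x.unshift μ, μ⟩) * g ⟨x.unshift μ, μ⟩ := by
    rw [Finset.mul_sum, ← sum_ite_tgt_eq x (fun b => (c : ℂ) * ((starRingEnd ℂ) (cfg U b) * g b))]
    refine Finset.sum_congr rfl fun b _ => ?_
    simp only [eq_comm (a := x), mul_assoc]
  have h2 : ∑ b : PBond P j, (if x = b.src then (c : ℂ) * 1 * g b else 0) = (c : ℂ) * ∑ μ : Fin P.d, g ⟨x, μ⟩ := by
    rw [Finset.mul_sum, ← sum_ite_src_eq x (fun b => (c : ℂ) * g b)]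
    refine Finset.sum_congr rfl fun b _ => ?_
    simp only [eq_comm (a := x), mul_one]
  rw [h1, h2, mul_sub]

/-- kernel: **`D_u^*` is bounded on `ℓ^∞`, locally**: if `|g| ≤ G` on the `2d` bonds at `x`, then `|(D_u^*g)(x)| ≤ |c|·2d·G`.
[cite: BalabanImbrieJaffe1988, (3.3) p.265] -/
theorem norm_conjTranspose_dN_univ_mulVec_le {c G : ℝ} (U : GaugeField P j U1) {g : PBond P j → ℂ} {x : Balaban1983to89.Site P j}
    (hG : ∀ μ : Fin P.d, ‖g ⟨x.unshift μ, μ⟩‖ ≤ G ∧ ‖g ⟨x, μ⟩‖ ≤ G) :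
    ‖((dN c U univ)ᴴ *ᵥ g) x‖ ≤ |c| * (2 * P.d) * G := by
  rw [conjTranspose_dN_univ_mulVec_apply, norm_mul, Complex.norm_real, Real.norm_eq_abs, mul_assoc]
  refine mul_le_mul_of_nonneg_left ?_ (abs_nonneg c)
  calc ‖∑ μ : Fin P.d, (starRingEnd ℂ) (cfg U ⟨x.unshift μ, μ⟩) * g ⟨x.unshift μ, μ⟩ - ∑ μ : Fin P.d, g ⟨x, μ⟩‖
      ≤ ‖∑ μ : Fin P.d, (starRingEnd ℂ) (cfg U ⟨x.unshift μ, μ⟩) * g ⟨x.unshift μ, μ⟩‖ + ‖∑ μ : Fin P.d, g ⟨x, μ⟩‖ := norm_sub_le _ _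
    _ ≤ ∑ μ : Fin P.d, ‖(starRingEnd ℂ) (cfg U ⟨x.unshift μ, μ⟩) * g ⟨x.unshift μ, μ⟩‖ + ∑ μ : Fin P.d, ‖g ⟨x, μ⟩‖ :=
        add_le_add (norm_sum_le _ _) (norm_sum_le _ _)
    _ ≤ ∑ _μ : Fin P.d, G + ∑ _μ : Fin P.d, G := by
        refine add_le_add (Finset.sum_le_sum fun μ _ => ?_) (Finset.sum_le_sum fun μ _ => (hG μ).2)
        have hcfg : ‖cfg U (⟨x.unshift μ, μ⟩ : PBond P j)‖ = 1 := BIJ88Sect3Statements.norm_toC _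
        rw [norm_mul, RCLike.norm_conj, hcfg, one_mul]
        exact (hG μ).1
    _ = 2 * P.d * G := by rw [Finset.sum_const, Finset.card_univ, Fintype.card_fin, nsmul_eq_mul]; ring

/-! ### The block average `Q(u)` and its adjoint, pointwise -/

/-- kernel: **`(Q(u)ᴴχ)(x) = L^{−d}\overline{u(Γ_{y_x x})}χ(y_x)`**, `y_x` the block of `x` — one term. [cite: BalabanImbrieJaffe1985, (2.6) p.303] -/
theorem conjTranspose_qMatT_mulVec_apply (U : GaugeField P j U1) (χ : Balaban1983to89.Site P (j + 1) → ℂ) (x : Balaban1983to89.Site P j) :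
    ((qMatT U 1)ᴴ *ᵥ χ) x = (starRingEnd ℂ) (((P.L : ℂ) ^ P.d)⁻¹ * holCK U 1 x) * χ (blkIter 1 x) := by
  rw [mulVec, dotProduct]
  simp only [conjTranspose_apply, qMatT_apply, mem_blockK, one_mul, Complex.star_def, apply_ite (starRingEnd ℂ), map_zero, ite_mul,
    zero_mul]
  rw [Finset.sum_ite_eq]
  simp

/-- kernel: **`|(Q(u)ᴴχ)(x)| = L^{−d}|χ(y_x)|`**. [cite: BalabanImbrieJaffe1985, (2.6) p.303] -/
theorem norm_conjTranspose_qMatT_mulVec (U : GaugeField P j U1) (χ : Balaban1983to89.Site P (j + 1) → ℂ) (x : Balaban1983to89.Site P j) :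
    ‖((qMatT U 1)ᴴ *ᵥ χ) x‖ = ((P.L : ℝ) ^ P.d)⁻¹ * ‖χ (blkIter 1 x)‖ := by
  rw [conjTranspose_qMatT_mulVec_apply, norm_mul, RCLike.norm_conj, norm_mul, norm_holCK, mul_one, norm_inv, norm_pow,
    Complex.norm_natCast]

/-- kernel: `(Q(u)φ)(y) = 0` when `φ` vanishes on the block `B(y)`. [cite: BalabanImbrieJaffe1985, (2.6) p.303] -/
theorem qMatT_mulVec_eq_zero_of_forall (U : GaugeField P j U1) {φ : Balaban1983to89.Site P j → ℂ} {y : Balaban1983to89.Site P (j + 1)}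
    (h : ∀ x ∈ blockK 1 y, φ x = 0) : (qMatT U 1 *ᵥ φ) y = 0 := by
  rw [qMatT_mulVec, qCovK_apply]
  rw [Finset.sum_eq_zero fun x hx => by rw [h x hx, mul_zero], mul_zero]

/-- kernel: **the first-step scalar operator acts as `D_u^*D_u + κQ(u)ᴴQ(u)`** (p31's `nOp κ c U 1 univ` on the whole unit torus; print's
`−Δ_{u₁} + aL^{−2}Q(u₁)^*Q(u₁)` of (3.31), `κ = aL^{−2}`). [cite: BalabanImbrieJaffe1988, (3.31) p.270] -/
theorem nOp_univ_mulVec (κ c : ℝ) (U : GaugeField P j U1) (φ : Balaban1983to89.Site P j → ℂ) :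
    nOp κ c U 1 univ *ᵥ φ = (dN c U univ)ᴴ *ᵥ (dN c U univ *ᵥ φ) + (κ : ℂ) • ((qMatT U 1)ᴴ *ᵥ (qMatT U 1 *ᵥ φ)) := by
  rw [nOp_eq, add_mulVec, smul_mulVec, ← mulVec_mulVec, ← mulVec_mulVec]
  rfl


/-! ### The Dirichlet restriction `H|_Λ` ((2.39)/(2.40)) against the torus operator -/

section Compress

variable {S : Type*} [Fintype S] [DecidableEq S]

omit [Fintype S] in
/-- kernel: the extension by zero of the restriction of `φ` to `Λ` is `1_Λφ`. [cite: BalabanImbrieJaffe1988, (2.39) p.264] -/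
theorem ext0_restrict (Λ : Finset S) (φ : S → ℂ) : ext0 Λ (fun y : ↥Λ => φ y) = fun y => if y ∈ Λ then φ y else 0 := by
  funext y
  unfold ext0
  split_ifs <;> rfl

/-- kernel: **`(H|_Λ φ|_Λ)(x) = (Hφ)(x) − (H(1_{Λᶜ}φ))(x)`** for `x ∈ Λ` — the Dirichlet restriction differs from the torus operator by the
action on the field OUTSIDE `Λ` (a boundary-layer term for a local `H`). [cite: BalabanImbrieJaffe1988, (2.39) p.264] -/
theorem compress_mulVec_restrict_apply (Λ : Finset S) (M : Matrix S S ℂ) (φ : S → ℂ) (x : ↥Λ) :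
    (compress Λ M *ᵥ fun y : ↥Λ => φ y) x = (M *ᵥ φ) x - (M *ᵥ fun y => if y ∈ Λ then 0 else φ y) x := by
  have hsplit : φ = (fun y => if y ∈ Λ then φ y else 0) + fun y => if y ∈ Λ then 0 else φ y := by
    funext y; simp only [Pi.add_apply]; split_ifs <;> simp
  rw [← mulVec_ext0_coe, ext0_restrict, eq_sub_iff_add_eq, ← Pi.add_apply, ← mulVec_add, ← hsplit]

omit [Fintype S] in
/-- kernel: `C_Λ(H|_Λ v) = v` for `C_Λ = (H|_Λ)^{−1}` ((2.40)). [cite: BalabanImbrieJaffe1988, (2.40) p.264] -/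
theorem inv_mulVec_compress_mulVec {Λ : Finset S} {M : Matrix S S ℂ} (hU : IsUnit (compress Λ M)) (v : ↥Λ → ℂ) :
    (compress Λ M)⁻¹ *ᵥ (compress Λ M *ᵥ v) = v := by
  rw [mulVec_mulVec, nonsing_inv_mul _ ((isUnit_iff_isUnit_det _).1 hU), one_mulVec]

/-- kernel: `|(Kv)(x)| ≤ Σ_{x₂}|K(x,x₂)||v(x₂)|`. [folklore] -/
private theorem norm_mulVec_apply_le {ι : Type*} [Fintype ι] (K : Matrix ι ι ℂ) (v : ι → ℂ) (x : ι) :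
    ‖(K *ᵥ v) x‖ ≤ ∑ x₂, ‖K x x₂‖ * ‖v x₂‖ := by
  rw [mulVec, dotProduct]
  exact (norm_sum_le _ _).trans (Finset.sum_le_sum fun x₂ _ => (norm_mul_le _ _))

end Compress

/-! ## §1  THE FLUCTUATION IDENTITY: `φ − κC_ΛQ(u₁)ᴴψ = C_Λ[D_{u₁}^*(D_{u₁}φ) − κQ(u₁)ᴴ(ψ − Q(u₁)φ) − ∂Λ-term]` -/

/-- **THE FLUCTUATION IDENTITY behind «|φ^{(0)}| ≦ cp(e₀)»** (p. 297: *"we can replace Q(u_{k+1})*ψ with φ in this bound"*; [8] Lemma 2.7).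
Let `H = D_{u₁}^*D_{u₁} + κQ(u₁)ᴴQ(u₁)` on the unit torus (p31's `nOp κ c U₁ 1 univ`; print's `−Δ_{u₁} + aL^{−2}Q(u₁)^*Q(u₁)`, `κ = aL^{−2}`),
`C_Λ = (H|_Λ)^{−1}` its Dirichlet covariance on `Λ` ((2.40) at `k = 0`).  Then for every `x ∈ Λ`,
`φ(x) − κ(C_Λ (Q(u₁)ᴴψ)|_Λ)(x) = (C_Λ w)(x)`, `w = (D_{u₁}^*D_{u₁}φ)|_Λ − κ(Q(u₁)ᴴ(ψ − Q(u₁)φ))|_Λ − (H(1_{Λᶜ}φ))|_Λ`: after the global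
part of the translation (3.30) the old field is expressed through the SMALL quantities `D_{u₁}φ`, `ψ − Q(u₁)φ` of (3.15) (no `λ₀^{−1/4}`) and a
term living on the boundary layer of `Λ`. [cite: BalabanImbrieJaffe1988, (3.33) p.270] -/
theorem fluct_identity (κ c : ℝ) (U : GaugeField P j U1) {Λ : Finset (Balaban1983to89.Site P j)}
    (hU : IsUnit (compress Λ (nOp κ c U 1 univ))) (φ : Balaban1983to89.Site P j → ℂ) (ψ : Balaban1983to89.Site P (j + 1) → ℂ) (x : ↥Λ) :
    φ x - (κ : ℂ) * ((compress Λ (nOp κ c U 1 univ))⁻¹ *ᵥ fun x₂ : ↥Λ => ((qMatT U 1)ᴴ *ᵥ ψ) x₂) x =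
      ((compress Λ (nOp κ c U 1 univ))⁻¹ *ᵥ fun x₂ : ↥Λ =>
        ((dN c U univ)ᴴ *ᵥ (dN c U univ *ᵥ φ)) x₂ - (κ : ℂ) * ((qMatT U 1)ᴴ *ᵥ (ψ - qMatT U 1 *ᵥ φ)) x₂
          - (nOp κ c U 1 univ *ᵥ fun y => if y ∈ Λ then 0 else φ y) x₂) x := by
  set H := nOp κ c U 1 univ with hH
  set C := (compress Λ H)⁻¹ with hC
  have hv : φ x = (C *ᵥ (compress Λ H *ᵥ fun y : ↥Λ => φ y)) x := by
    rw [inv_mulVec_compress_mulVec hU]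
  have key : (fun x₂ : ↥Λ => ((dN c U univ)ᴴ *ᵥ (dN c U univ *ᵥ φ)) x₂ - (κ : ℂ) * ((qMatT U 1)ᴴ *ᵥ (ψ - qMatT U 1 *ᵥ φ)) x₂
        - (H *ᵥ fun y => if y ∈ Λ then 0 else φ y) x₂) =
      (compress Λ H *ᵥ fun y : ↥Λ => φ y) - (κ : ℂ) • fun x₂ : ↥Λ => ((qMatT U 1)ᴴ *ᵥ ψ) x₂ := by
    funext x₂
    rw [Pi.sub_apply, Pi.smul_apply, smul_eq_mul, compress_mulVec_restrict_apply, hH, nOp_univ_mulVec κ c U φ, Pi.add_apply,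
      Pi.smul_apply, smul_eq_mul, mulVec_sub, Pi.sub_apply]
    ring
  rw [key, mulVec_sub, mulVec_smul, Pi.sub_apply, Pi.smul_apply, smul_eq_mul, ← hv]


/-! ## §2  The three terms of the identity: sizes -/

section Terms

variable {Λ : Finset (Balaban1983to89.Site P j)}

/-- kernel: the covariant derivative of `1_{Λᶜ}φ` vanishes on the bonds inside `Λ`. [cite: BalabanImbrieJaffe1988, (3.33) p.270] -/
theorem covD_indicator_compl_eq_zero (c : ℝ) (u : PBond P j → ℂ) (φ : Balaban1983to89.Site P j → ℂ) {b : PBond P j}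
    (hs : b.src ∈ Λ) (ht : b.tgt ∈ Λ) : covD c u (fun y => if y ∈ Λ then 0 else φ y) b = 0 := by
  simp [covD, hs, ht]

/-- kernel: on a bond with an end in `Λ`, `|D_u(1_{Λᶜ}φ)(b)| ≤ |c|·Φ` when `|φ| ≤ Φ` on the sites outside `Λ` adjacent to `Λ`.
[cite: BalabanImbrieJaffe1988, (3.33) p.270] -/
theorem norm_covD_indicator_compl_le {c Φ : ℝ} (U : GaugeField P j U1) {φ : Balaban1983to89.Site P j → ℂ} (hΦ0 : 0 ≤ Φ)
    (hΦ : ∀ b : PBond P j, (b.src ∈ Λ → b.tgt ∉ Λ → ‖φ b.tgt‖ ≤ Φ) ∧ (b.tgt ∈ Λ → b.src ∉ Λ → ‖φ b.src‖ ≤ Φ))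
    {b : PBond P j} (hb : b.src ∈ Λ ∨ b.tgt ∈ Λ) :
    ‖covD c (cfg U) (fun y => if y ∈ Λ then 0 else φ y) b‖ ≤ |c| * Φ := by
  have hc : ‖(c : ℂ)‖ = |c| := by rw [Complex.norm_real, Real.norm_eq_abs]
  unfold covD
  rw [norm_mul, hc]
  refine mul_le_mul_of_nonneg_left ?_ (abs_nonneg c)
  have hcfg : ‖cfg U b‖ = 1 := BIJ88Sect3Statements.norm_toC _
  by_cases hs : b.src ∈ Λ <;> by_cases ht : b.tgt ∈ Λ
  · simp [hs, ht, hΦ0]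
  · simpa [hs, ht, hcfg] using (hΦ b).1 hs ht
  · simpa [hs, ht] using (hΦ b).2 ht hs
  · exact absurd hb (by simp [hs, ht])

/-- **THE `∂Λ`-TERM IS A BOUNDARY-LAYER TERM OF SIZE `2dc²Φ`**: for a `1`-block union `Λ` and `x₂ ∈ Λ`, `|(H(1_{Λᶜ}φ))(x₂)| ≤ |c|·2d·|c|Φ`
when `|φ| ≤ Φ` on the sites outside `Λ` adjacent to `Λ` (the `Q(u₁)ᴴQ(u₁)` part does not see across the block union; the `D^*D` part sees one
layer). [cite: BalabanImbrieJaffe1988, (3.33) p.270] -/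
theorem norm_nOp_mulVec_indicator_compl_le {κ c Φ : ℝ} (U : GaugeField P j U1) (hΛ : BIJ88NeumannNoZeroModesTorus.IsBlockUnion 1 Λ)
    {φ : Balaban1983to89.Site P j → ℂ} (hΦ0 : 0 ≤ Φ)
    (hΦ : ∀ b : PBond P j, (b.src ∈ Λ → b.tgt ∉ Λ → ‖φ b.tgt‖ ≤ Φ) ∧ (b.tgt ∈ Λ → b.src ∉ Λ → ‖φ b.src‖ ≤ Φ))
    {x₂ : Balaban1983to89.Site P j} (hx₂ : x₂ ∈ Λ) :
    ‖(nOp κ c U 1 univ *ᵥ fun y => if y ∈ Λ then 0 else φ y) x₂‖ ≤ |c| * (2 * P.d) * (|c| * Φ) := by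
  have hQ : (qMatT U 1 *ᵥ fun y => if y ∈ Λ then 0 else φ y) (blkIter 1 x₂) = 0 :=
    qMatT_mulVec_eq_zero_of_forall U fun x' hx' => by rw [if_pos (hΛ x₂ hx₂ hx')]
  rw [nOp_univ_mulVec, Pi.add_apply, Pi.smul_apply, conjTranspose_qMatT_mulVec_apply, hQ, mul_zero, smul_zero, add_zero]
  refine norm_conjTranspose_dN_univ_mulVec_le U fun μ => ⟨?_, ?_⟩
  · rw [dN_univ_mulVec]
    exact norm_covD_indicator_compl_le U hΦ0 hΦ (Or.inr (by rw [PBond.tgt]; exact (shift_unshift x₂ μ).symm ▸ hx₂))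
  · rw [dN_univ_mulVec]
    exact norm_covD_indicator_compl_le U hΦ0 hΦ (Or.inl hx₂)

/-- kernel: **the `∂Λ`-term vanishes in the interior of `Λ`** (all `2d` neighbours of `x₂` in `Λ`). [cite: BalabanImbrieJaffe1988, (3.33) p.270] -/
theorem nOp_mulVec_indicator_compl_eq_zero (κ c : ℝ) (U : GaugeField P j U1) (hΛ : BIJ88NeumannNoZeroModesTorus.IsBlockUnion 1 Λ)
    (φ : Balaban1983to89.Site P j → ℂ) {x₂ : Balaban1983to89.Site P j} (hx₂ : x₂ ∈ Λ)
    (hint : ∀ μ : Fin P.d, x₂.shift μ ∈ Λ ∧ x₂.unshift μ ∈ Λ) :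
    (nOp κ c U 1 univ *ᵥ fun y => if y ∈ Λ then 0 else φ y) x₂ = 0 := by
  have hQ : (qMatT U 1 *ᵥ fun y => if y ∈ Λ then 0 else φ y) (blkIter 1 x₂) = 0 :=
    qMatT_mulVec_eq_zero_of_forall U fun x' hx' => by rw [if_pos (hΛ x₂ hx₂ hx')]
  rw [nOp_univ_mulVec, Pi.add_apply, Pi.smul_apply, conjTranspose_qMatT_mulVec_apply, hQ, mul_zero, smul_zero, add_zero,
    conjTranspose_dN_univ_mulVec_apply]
  have h1 : ∀ μ : Fin P.d, (dN c U univ *ᵥ fun y => if y ∈ Λ then 0 else φ y) ⟨x₂.unshift μ, μ⟩ = 0 := fun μ => by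
    rw [dN_univ_mulVec]
    exact covD_indicator_compl_eq_zero c _ φ (hint μ).2 (by rw [PBond.tgt]; exact (shift_unshift x₂ μ).symm ▸ hx₂)
  have h2 : ∀ μ : Fin P.d, (dN c U univ *ᵥ fun y => if y ∈ Λ then 0 else φ y) ⟨x₂, μ⟩ = 0 := fun μ => by
    rw [dN_univ_mulVec]
    exact covD_indicator_compl_eq_zero c _ φ hx₂ (hint μ).1
  simp [h1, h2]

/-- kernel: **the `D^*D` term**: `|(D_{u₁}^*D_{u₁}φ)(x₂)| ≤ |c|·2d·p_D` when `|D_{u₁}φ| ≤ p_D` on the bonds meeting `Λ` ((3.15): `|D_uφ| ≦ p(e₀)`).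
[cite: BalabanImbrieJaffe1988, (3.15) p.267] -/
theorem norm_lapTerm_le {c pD : ℝ} (U : GaugeField P j U1) {φ : Balaban1983to89.Site P j → ℂ}
    (hD : ∀ b : PBond P j, (b.src ∈ Λ ∨ b.tgt ∈ Λ) → ‖covD c (cfg U) φ b‖ ≤ pD) {x₂ : Balaban1983to89.Site P j} (hx₂ : x₂ ∈ Λ) :
    ‖((dN c U univ)ᴴ *ᵥ (dN c U univ *ᵥ φ)) x₂‖ ≤ |c| * (2 * P.d) * pD := by
  refine norm_conjTranspose_dN_univ_mulVec_le U fun μ => ⟨?_, ?_⟩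
  · rw [dN_univ_mulVec]
    exact hD _ (Or.inr (by rw [PBond.tgt]; exact (shift_unshift x₂ μ).symm ▸ hx₂))
  · rw [dN_univ_mulVec]
    exact hD _ (Or.inl hx₂)

/-- kernel: **the `Q(u₁)ᴴ(ψ − Q(u₁)φ)` term**: `|(Q(u₁)ᴴ(ψ − Q(u₁)φ))(x₂)| ≤ L^{−d}p_Q` when `|ψ(y) − (Q(u₁)φ)(y)| ≤ p_Q` on the blocks inside `Λ`
((3.15): `|ψ − Q(u)φ| ≦ p(e₀)`). [cite: BalabanImbrieJaffe1988, (3.15) p.267] -/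
theorem norm_qTerm_le {pQ : ℝ} (U : GaugeField P j U1) (hΛ : BIJ88NeumannNoZeroModesTorus.IsBlockUnion 1 Λ)
    {φ : Balaban1983to89.Site P j → ℂ} {ψ : Balaban1983to89.Site P (j + 1) → ℂ}
    (hQ : ∀ y : Balaban1983to89.Site P (j + 1), blockK 1 y ⊆ Λ → ‖ψ y - (qMatT U 1 *ᵥ φ) y‖ ≤ pQ)
    {x₂ : Balaban1983to89.Site P j} (hx₂ : x₂ ∈ Λ) :
    ‖((qMatT U 1)ᴴ *ᵥ (ψ - qMatT U 1 *ᵥ φ)) x₂‖ ≤ ((P.L : ℝ) ^ P.d)⁻¹ * pQ := by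
  rw [norm_conjTranspose_qMatT_mulVec, Pi.sub_apply]
  exact mul_le_mul_of_nonneg_left (hQ _ (hΛ x₂ hx₂)) (by positivity)

/-- kernel: `|Q(u₁)ᴴψ(x₂)| ≤ L^{−d}Ψ` when `|ψ| ≤ Ψ` on the blocks inside `Λ` ((3.32): `|ψ(y)| ≦ cp(e₀)λ₀^{−1/4}`).
[cite: BalabanImbrieJaffe1988, (3.32) p.270] -/
theorem norm_qAdj_le {Ψ : ℝ} (U : GaugeField P j U1) (hΛ : BIJ88NeumannNoZeroModesTorus.IsBlockUnion 1 Λ)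
    {ψ : Balaban1983to89.Site P (j + 1) → ℂ} (hΨ : ∀ y : Balaban1983to89.Site P (j + 1), blockK 1 y ⊆ Λ → ‖ψ y‖ ≤ Ψ)
    {x₂ : Balaban1983to89.Site P j} (hx₂ : x₂ ∈ Λ) :
    ‖((qMatT U 1)ᴴ *ᵥ ψ) x₂‖ ≤ ((P.L : ℝ) ^ P.d)⁻¹ * Ψ := by
  rw [norm_conjTranspose_qMatT_mulVec]
  exact mul_le_mul_of_nonneg_left (hΨ _ (hΛ x₂ hx₂)) (by positivity)

end Terms


/-! ## §3  The fluctuation bound with abstract kernel constants (row sum `K`, tail row sum `K_R`, localization defect `δ′`) -/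

section Abstract

variable {Λ : Finset (Balaban1983to89.Site P j)}

/-- **THE FLUCTUATION BOUND, GLOBAL COVARIANCE** ([8] Lemma 2.7 / (2.113)–(2.114) in the present model; p. 297 *"the corresponding statement
with C^{(k)}(u_{k+1}) was proven in [8, Eq. (2.113)]"*).  For a `1`-block union `Λ`, `H = D_{u₁}^*D_{u₁} + κQ(u₁)ᴴQ(u₁)` with `H|_Λ`
invertible, `C_Λ = (H|_Λ)^{−1}`, and `x ∈ Λ`: if `|D_{u₁}φ| ≤ p_D` on the bonds meeting `Λ`, `|ψ − Q(u₁)φ| ≤ p_Q` on the blocks of `Λ`, `|φ| ≤ Φ`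
on the outer layer of `Λ`, every site of `Λ` with a neighbour outside `Λ` is at torus distance `≥ R` from `x` (LOCATED MARGIN), and the row of
`C_Λ` at `x` has `Σ_{x₂}|C_Λ(x,x₂)| ≤ K`, `Σ_{|x−x₂| ≥ R}|C_Λ(x,x₂)| ≤ K_R`, then
`|φ(x) − κ(C_Λ(Q(u₁)ᴴψ)|_Λ)(x)| ≤ K(2d|c|p_D + κL^{−d}p_Q) + K_R·2dc²Φ`. [cite: BalabanImbrieJaffe1988, (3.33) p.270] -/
theorem norm_fluct_le {κ c : ℝ} (hκ : 0 ≤ κ) (U : GaugeField P j U1) (hΛ : BIJ88NeumannNoZeroModesTorus.IsBlockUnion 1 Λ)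
    (hU : IsUnit (compress Λ (nOp κ c U 1 univ))) {φ : Balaban1983to89.Site P j → ℂ} {ψ : Balaban1983to89.Site P (j + 1) → ℂ}
    {pD pQ Φ R K KR : ℝ} (hΦ0 : 0 ≤ Φ)
    (hD : ∀ b : PBond P j, (b.src ∈ Λ ∨ b.tgt ∈ Λ) → ‖covD c (cfg U) φ b‖ ≤ pD)
    (hQ : ∀ y : Balaban1983to89.Site P (j + 1), blockK 1 y ⊆ Λ → ‖ψ y - (qMatT U 1 *ᵥ φ) y‖ ≤ pQ)
    (hΦ : ∀ b : PBond P j, (b.src ∈ Λ → b.tgt ∉ Λ → ‖φ b.tgt‖ ≤ Φ) ∧ (b.tgt ∈ Λ → b.src ∉ Λ → ‖φ b.src‖ ≤ Φ))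
    (x : ↥Λ)
    (hR : ∀ x₂ ∈ Λ, (∃ μ : Fin P.d, x₂.shift μ ∉ Λ ∨ x₂.unshift μ ∉ Λ) → R ≤ B5Ineq137Torus.T P j x x₂)
    (hK : ∑ x₂ : ↥Λ, ‖(compress Λ (nOp κ c U 1 univ))⁻¹ x x₂‖ ≤ K)
    (hKR : ∑ x₂ ∈ univ.filter (fun x₂ : ↥Λ => R ≤ B5Ineq137Torus.T P j x x₂), ‖(compress Λ (nOp κ c U 1 univ))⁻¹ x x₂‖ ≤ KR) :
    ‖φ x - (κ : ℂ) * ((compress Λ (nOp κ c U 1 univ))⁻¹ *ᵥ fun x₂ : ↥Λ => ((qMatT U 1)ᴴ *ᵥ ψ) x₂) x‖ ≤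
      K * (|c| * (2 * P.d) * pD + κ * ((P.L : ℝ) ^ P.d)⁻¹ * pQ) + KR * (|c| * (2 * P.d) * (|c| * Φ)) := by
  set C := (compress Λ (nOp κ c U 1 univ))⁻¹ with hC
  set A := |c| * (2 * P.d) * pD + κ * ((P.L : ℝ) ^ P.d)⁻¹ * pQ with hA
  set B := |c| * (2 * P.d) * (|c| * Φ) with hB
  have hpD : 0 ≤ pD := (norm_nonneg _).trans (hD ⟨x, ⟨0, P.hd⟩⟩ (Or.inl x.2))
  have hpQ : 0 ≤ pQ := (norm_nonneg _).trans (hQ (blkIter 1 (x : Balaban1983to89.Site P j)) (hΛ x x.2))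
  have hA0 : 0 ≤ A := by positivity
  have hB0 : 0 ≤ B := by positivity
  have hκn : ‖(κ : ℂ)‖ = κ := by rw [Complex.norm_real, Real.norm_eq_abs, abs_of_nonneg hκ]
  rw [fluct_identity κ c U hU φ ψ x]
  refine (norm_mulVec_apply_le _ _ _).trans ?_
  have hw : ∀ x₂ : ↥Λ, ‖((dN c U univ)ᴴ *ᵥ (dN c U univ *ᵥ φ)) x₂ - (κ : ℂ) * ((qMatT U 1)ᴴ *ᵥ (ψ - qMatT U 1 *ᵥ φ)) x₂
        - (nOp κ c U 1 univ *ᵥ fun y => if y ∈ Λ then 0 else φ y) x₂‖ ≤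
      A + if R ≤ B5Ineq137Torus.T P j x x₂ then B else 0 := by
    intro x₂
    have h1 := norm_lapTerm_le U hD x₂.2
    have h2 : ‖(κ : ℂ) * ((qMatT U 1)ᴴ *ᵥ (ψ - qMatT U 1 *ᵥ φ)) x₂‖ ≤ κ * ((P.L : ℝ) ^ P.d)⁻¹ * pQ := by
      rw [norm_mul, hκn, mul_assoc]
      exact mul_le_mul_of_nonneg_left (norm_qTerm_le U hΛ hQ x₂.2) hκ
    have h3 : ‖(nOp κ c U 1 univ *ᵥ fun y => if y ∈ Λ then 0 else φ y) x₂‖ ≤ if R ≤ B5Ineq137Torus.T P j x x₂ then B else 0 := by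
      by_cases hint : ∀ μ : Fin P.d, (x₂ : Balaban1983to89.Site P j).shift μ ∈ Λ ∧ (x₂ : Balaban1983to89.Site P j).unshift μ ∈ Λ
      · rw [nOp_mulVec_indicator_compl_eq_zero κ c U hΛ φ x₂.2 hint, norm_zero]
        split_ifs
        · exact hB0
        · exact le_rfl
      · have hex : ∃ μ : Fin P.d, (x₂ : Balaban1983to89.Site P j).shift μ ∉ Λ ∨ (x₂ : Balaban1983to89.Site P j).unshift μ ∉ Λ := by
          obtain ⟨μ, hμ⟩ := not_forall.1 hint
          exact ⟨μ, not_and_or.1 hμ⟩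
        rw [if_pos (hR x₂ x₂.2 hex)]
        exact norm_nOp_mulVec_indicator_compl_le U hΛ hΦ0 hΦ x₂.2
    calc _ ≤ ‖((dN c U univ)ᴴ *ᵥ (dN c U univ *ᵥ φ)) x₂ - (κ : ℂ) * ((qMatT U 1)ᴴ *ᵥ (ψ - qMatT U 1 *ᵥ φ)) x₂‖
          + ‖(nOp κ c U 1 univ *ᵥ fun y => if y ∈ Λ then 0 else φ y) x₂‖ := norm_sub_le _ _
      _ ≤ (‖((dN c U univ)ᴴ *ᵥ (dN c U univ *ᵥ φ)) x₂‖ + ‖(κ : ℂ) * ((qMatT U 1)ᴴ *ᵥ (ψ - qMatT U 1 *ᵥ φ)) x₂‖)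
          + ‖(nOp κ c U 1 univ *ᵥ fun y => if y ∈ Λ then 0 else φ y) x₂‖ := add_le_add (norm_sub_le _ _) le_rfl
      _ ≤ A + _ := add_le_add (add_le_add h1 h2) h3
  calc ∑ x₂ : ↥Λ, ‖C x x₂‖ * ‖((dN c U univ)ᴴ *ᵥ (dN c U univ *ᵥ φ)) x₂ - (κ : ℂ) * ((qMatT U 1)ᴴ *ᵥ (ψ - qMatT U 1 *ᵥ φ)) x₂
          - (nOp κ c U 1 univ *ᵥ fun y => if y ∈ Λ then 0 else φ y) x₂‖
      ≤ ∑ x₂ : ↥Λ, ‖C x x₂‖ * (A + if R ≤ B5Ineq137Torus.T P j x x₂ then B else 0) :=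
        Finset.sum_le_sum fun x₂ _ => mul_le_mul_of_nonneg_left (hw x₂) (norm_nonneg _)
    _ = A * ∑ x₂ : ↥Λ, ‖C x x₂‖ + (∑ x₂ ∈ univ.filter (fun x₂ : ↥Λ => R ≤ B5Ineq137Torus.T P j x x₂), ‖C x x₂‖) * B := by
        rw [Finset.sum_mul, Finset.mul_sum, Finset.sum_filter, ← Finset.sum_add_distrib]
        refine Finset.sum_congr rfl fun x₂ _ => ?_
        split_ifs <;> ring
    _ ≤ A * K + KR * B := by
        have := mul_le_mul_of_nonneg_left hK hA0
        have := mul_le_mul_of_nonneg_right hKR hB0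
        linarith
    _ = K * A + KR * B := by ring

/-- **THE LOCALIZATION SWAP `C_Λ → C_{Λ,loc}`** (p. 297 *"Note that C^{(k)}_{loc}(u_{k+1}) is almost equal to C^{(k)}(u_{k+1})"*; (2.47)): for any
kernel `K_loc` on `Λ` whose row at `x` is `ℓ¹`-close to that of `C_Λ`, `Σ_{x₂}|K_loc(x,x₂) − C_Λ(x,x₂)| ≤ δ′`, and `|ψ| ≤ Ψ` on the blocks of `Λ`:
`|κ(C_ΛQ(u₁)ᴴψ)(x) − κ(K_locQ(u₁)ᴴψ)(x)| ≤ κδ′L^{−d}Ψ`. [cite: BalabanImbrieJaffe1988, (2.47) p.265] -/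
theorem norm_swap_le {κ : ℝ} (hκ : 0 ≤ κ) (U : GaugeField P j U1) (hΛ : BIJ88NeumannNoZeroModesTorus.IsBlockUnion 1 Λ)
    {ψ : Balaban1983to89.Site P (j + 1) → ℂ} {Ψ δ' : ℝ} (hΨ : ∀ y : Balaban1983to89.Site P (j + 1), blockK 1 y ⊆ Λ → ‖ψ y‖ ≤ Ψ)
    (C Kl : Matrix ↥Λ ↥Λ ℂ) (x : ↥Λ) (hδ : ∑ x₂ : ↥Λ, ‖Kl x x₂ - C x x₂‖ ≤ δ') :
    ‖(κ : ℂ) * (C *ᵥ fun x₂ : ↥Λ => ((qMatT U 1)ᴴ *ᵥ ψ) x₂) x - (κ : ℂ) * (Kl *ᵥ fun x₂ : ↥Λ => ((qMatT U 1)ᴴ *ᵥ ψ) x₂) x‖ ≤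
      κ * (δ' * (((P.L : ℝ) ^ P.d)⁻¹ * Ψ)) := by
  have hΨ0 : 0 ≤ Ψ := (norm_nonneg _).trans (hΨ (blkIter 1 (x : Balaban1983to89.Site P j)) (hΛ x x.2))
  have hκn : ‖(κ : ℂ)‖ = κ := by rw [Complex.norm_real, Real.norm_eq_abs, abs_of_nonneg hκ]
  rw [← mul_sub, ← Pi.sub_apply, ← sub_mulVec, norm_mul, hκn]
  refine mul_le_mul_of_nonneg_left ?_ hκ
  calc ‖((C - Kl) *ᵥ fun x₂ : ↥Λ => ((qMatT U 1)ᴴ *ᵥ ψ) x₂) x‖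
      ≤ ∑ x₂ : ↥Λ, ‖(C - Kl) x x₂‖ * ‖((qMatT U 1)ᴴ *ᵥ ψ) x₂‖ := norm_mulVec_apply_le _ _ _
    _ ≤ ∑ x₂ : ↥Λ, ‖Kl x x₂ - C x x₂‖ * (((P.L : ℝ) ^ P.d)⁻¹ * Ψ) :=
        Finset.sum_le_sum fun x₂ _ => by
          rw [Matrix.sub_apply, norm_sub_rev]
          exact mul_le_mul_of_nonneg_left (norm_qAdj_le U hΛ hΨ x₂.2) (norm_nonneg _)
    _ ≤ δ' * (((P.L : ℝ) ^ P.d)⁻¹ * Ψ) := by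
        rw [← Finset.sum_mul]
        exact mul_le_mul_of_nonneg_right hδ (by positivity)

/-- **THE FLUCTUATION BOUND, LOCAL COVARIANCE — abstract constants.**  With the data of `norm_fluct_le` and a kernel `K_loc` on `Λ` with
`Σ_{x₂}|K_loc(x,x₂) − C_Λ(x,x₂)| ≤ δ′`, `|ψ| ≤ Ψ` on the blocks of `Λ`: the fluctuation field of (3.30) AT `x`, `φ^{(0)}(x) = φ(x) −
κ(K_locQ(u₁)ᴴψ)(x)`, obeys `|φ^{(0)}(x)| ≤ K(2d|c|p_D + κL^{−d}p_Q) + K_R·2dc²Φ + κδ′L^{−d}Ψ`. [cite: BalabanImbrieJaffe1988, (3.33) p.270] -/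
theorem norm_phi0_le_abstract {κ c : ℝ} (hκ : 0 ≤ κ) (U : GaugeField P j U1) (hΛ : BIJ88NeumannNoZeroModesTorus.IsBlockUnion 1 Λ)
    (hU : IsUnit (compress Λ (nOp κ c U 1 univ))) {φ : Balaban1983to89.Site P j → ℂ} {ψ : Balaban1983to89.Site P (j + 1) → ℂ}
    {pD pQ Φ Ψ R K KR δ' : ℝ} (hΦ0 : 0 ≤ Φ)
    (hD : ∀ b : PBond P j, (b.src ∈ Λ ∨ b.tgt ∈ Λ) → ‖covD c (cfg U) φ b‖ ≤ pD)
    (hQ : ∀ y : Balaban1983to89.Site P (j + 1), blockK 1 y ⊆ Λ → ‖ψ y - (qMatT U 1 *ᵥ φ) y‖ ≤ pQ)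
    (hΦ : ∀ b : PBond P j, (b.src ∈ Λ → b.tgt ∉ Λ → ‖φ b.tgt‖ ≤ Φ) ∧ (b.tgt ∈ Λ → b.src ∉ Λ → ‖φ b.src‖ ≤ Φ))
    (hΨ : ∀ y : Balaban1983to89.Site P (j + 1), blockK 1 y ⊆ Λ → ‖ψ y‖ ≤ Ψ)
    (x : ↥Λ)
    (hR : ∀ x₂ ∈ Λ, (∃ μ : Fin P.d, x₂.shift μ ∉ Λ ∨ x₂.unshift μ ∉ Λ) → R ≤ B5Ineq137Torus.T P j x x₂)
    (hK : ∑ x₂ : ↥Λ, ‖(compress Λ (nOp κ c U 1 univ))⁻¹ x x₂‖ ≤ K)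
    (hKR : ∑ x₂ ∈ univ.filter (fun x₂ : ↥Λ => R ≤ B5Ineq137Torus.T P j x x₂), ‖(compress Λ (nOp κ c U 1 univ))⁻¹ x x₂‖ ≤ KR)
    (Kl : Matrix ↥Λ ↥Λ ℂ) (hδ : ∑ x₂ : ↥Λ, ‖Kl x x₂ - (compress Λ (nOp κ c U 1 univ))⁻¹ x x₂‖ ≤ δ') :
    ‖φ x - (κ : ℂ) * (Kl *ᵥ fun x₂ : ↥Λ => ((qMatT U 1)ᴴ *ᵥ ψ) x₂) x‖ ≤
      K * (|c| * (2 * P.d) * pD + κ * ((P.L : ℝ) ^ P.d)⁻¹ * pQ) + KR * (|c| * (2 * P.d) * (|c| * Φ))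
        + κ * (δ' * (((P.L : ℝ) ^ P.d)⁻¹ * Ψ)) := by
  have h1 := norm_fluct_le hκ U hΛ hU hΦ0 hD hQ hΦ x hR hK hKR
  have h2 := norm_swap_le hκ U hΛ hΨ ((compress Λ (nOp κ c U 1 univ))⁻¹) Kl x hδ
  calc _ = ‖(φ x - (κ : ℂ) * ((compress Λ (nOp κ c U 1 univ))⁻¹ *ᵥ fun x₂ : ↥Λ => ((qMatT U 1)ᴴ *ᵥ ψ) x₂) x)
        + ((κ : ℂ) * ((compress Λ (nOp κ c U 1 univ))⁻¹ *ᵥ fun x₂ : ↥Λ => ((qMatT U 1)ᴴ *ᵥ ψ) x₂) x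
          - (κ : ℂ) * (Kl *ᵥ fun x₂ : ↥Λ => ((qMatT U 1)ᴴ *ᵥ ψ) x₂) x)‖ := by rw [sub_add_sub_cancel]
    _ ≤ _ := (norm_add_le _ _).trans (add_le_add h1 h2)

end Abstract


/-! ## §4  The kernel constants from the random walk expansion: (2.41) row sums and the (2.47) localization defect (p31/p13 BY NAME) -/

section Walk

variable {Λ : Finset (Balaban1983to89.Site P j)} {H : Matrix (Balaban1983to89.Site P j) (Balaban1983to89.Site P j) ℂ} {γ₀ c₀ δ₀ : ℝ}

/-- kernel: a sum of non-negative terms over the sites of `Λ` is at most the sum over the torus. [folklore] -/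
private theorem sum_coe_le_sum_univ (f : Balaban1983to89.Site P j → ℝ) (hf : ∀ y, 0 ≤ f y) : ∑ y : ↥Λ, f y ≤ ∑ y, f y := by
  rw [Finset.sum_coe_sort Λ f]
  exact Finset.sum_le_sum_of_subset_of_nonneg (Finset.subset_univ Λ) fun y _ _ => hf y

/-- **(2.41), ROW-SUMMED**: under [6] (5.6) for the charted `H|_Λ` (p31's `norm_inv_apply_le_walk`: `|C_Λ(x,x₂)| ≤ A_w e^{−(δ₀/8)|x−x₂|_T/M}`) the
rows of `C_Λ = (H|_Λ)^{−1}` are summable uniformly in the volume: `Σ_{x₂}|C_Λ(x,x₂)| ≤ A_w·K_d(δ₀/(8M))` (p38's torus radial sum `rowSum_T_le`).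
[cite: BalabanImbrieJaffe1988, (2.41) p.264] -/
theorem rowSum_inv_le_walk (hγ : 0 < γ₀) (hc : 0 ≤ c₀) (hδ : 0 < δ₀) (hA : B4.Hyp56 (chartSet Λ) (reOp Λ H) γ₀ c₀ δ₀)
    (hU : IsUnit (compress Λ H)) {M : ℕ} (hM : 5 ≤ M) (hMR : kR P.d 2 γ₀ c₀ δ₀ < M) (hMθ : thetaConst P.d 2 γ₀ c₀ δ₀ < M)
    (hθW : thetaW P.d 2 γ₀ c₀ δ₀ M < 1) (x : ↥Λ) :
    ∑ x₂ : ↥Λ, ‖(compress Λ H)⁻¹ x x₂‖ ≤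
      2 * (2 ^ P.d * γ₀⁻¹ * (1 - thetaW P.d 2 γ₀ c₀ δ₀ M)⁻¹ * Real.exp (δ₀ / 4)) * latticeConst P.d (δ₀ / 8 / M) := by
  have hM0 : (0 : ℝ) < M := by exact_mod_cast (show 0 < M by omega)
  have ha : 0 < δ₀ / 8 / M := by positivity
  calc ∑ x₂ : ↥Λ, ‖(compress Λ H)⁻¹ x x₂‖
      ≤ ∑ x₂ : ↥Λ, 2 * (2 ^ P.d * γ₀⁻¹ * (1 - thetaW P.d 2 γ₀ c₀ δ₀ M)⁻¹ * Real.exp (δ₀ / 4))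
          * Real.exp (-(δ₀ / 8 / M * B5Ineq137Torus.T P j x x₂)) :=
        Finset.sum_le_sum fun x₂ _ => by
          have h := norm_inv_apply_le_walk hγ hc hδ hA hU hM hMR hMθ hθW x x₂
          rwa [show -(δ₀ / 8) * (B5Ineq137Torus.T P j x.1 x₂.1 / M) = -(δ₀ / 8 / M * B5Ineq137Torus.T P j x x₂) by ring] at h
    _ = 2 * (2 ^ P.d * γ₀⁻¹ * (1 - thetaW P.d 2 γ₀ c₀ δ₀ M)⁻¹ * Real.exp (δ₀ / 4))
          * ∑ x₂ : ↥Λ, Real.exp (-(δ₀ / 8 / M * B5Ineq137Torus.T P j x x₂)) := by rw [Finset.mul_sum]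
    _ ≤ _ := by
        have hK : 0 ≤ 2 * (2 ^ P.d * γ₀⁻¹ * (1 - thetaW P.d 2 γ₀ c₀ δ₀ M)⁻¹ * Real.exp (δ₀ / 4)) := by
          have : 0 < 1 - thetaW P.d 2 γ₀ c₀ δ₀ M := by linarith
          positivity
        refine mul_le_mul_of_nonneg_left ?_ hK
        exact (sum_coe_le_sum_univ _ fun y => (Real.exp_pos _).le).trans (B5Ineq137Torus.rowSum_T_le P j ha x)

/-- **(2.41), TAIL ROW SUM** for the located margin: `Σ_{|x−x₂|_T ≥ R}|C_Λ(x,x₂)| ≤ A_w e^{−(δ₀/(16M))R}·K_d(δ₀/(16M))` (half the decay rate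
pays for the distance `R`, the other half for the sum). [cite: BalabanImbrieJaffe1988, (2.41) p.264] -/
theorem tailSum_inv_le_walk (hγ : 0 < γ₀) (hc : 0 ≤ c₀) (hδ : 0 < δ₀) (hA : B4.Hyp56 (chartSet Λ) (reOp Λ H) γ₀ c₀ δ₀)
    (hU : IsUnit (compress Λ H)) {M : ℕ} (hM : 5 ≤ M) (hMR : kR P.d 2 γ₀ c₀ δ₀ < M) (hMθ : thetaConst P.d 2 γ₀ c₀ δ₀ < M)
    (hθW : thetaW P.d 2 γ₀ c₀ δ₀ M < 1) (x : ↥Λ) (R : ℝ) :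
    ∑ x₂ ∈ univ.filter (fun x₂ : ↥Λ => R ≤ B5Ineq137Torus.T P j x x₂), ‖(compress Λ H)⁻¹ x x₂‖ ≤
      2 * (2 ^ P.d * γ₀⁻¹ * (1 - thetaW P.d 2 γ₀ c₀ δ₀ M)⁻¹ * Real.exp (δ₀ / 4)) * Real.exp (-(δ₀ / 16 / M * R))
        * latticeConst P.d (δ₀ / 16 / M) := by
  have hM0 : (0 : ℝ) < M := by exact_mod_cast (show 0 < M by omega)
  have ha : 0 < δ₀ / 16 / M := by positivity
  set Aw := 2 * (2 ^ P.d * γ₀⁻¹ * (1 - thetaW P.d 2 γ₀ c₀ δ₀ M)⁻¹ * Real.exp (δ₀ / 4)) with hAw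
  have hK : 0 ≤ Aw := by
    have : 0 < 1 - thetaW P.d 2 γ₀ c₀ δ₀ M := by linarith
    positivity
  calc ∑ x₂ ∈ univ.filter (fun x₂ : ↥Λ => R ≤ B5Ineq137Torus.T P j x x₂), ‖(compress Λ H)⁻¹ x x₂‖
      ≤ ∑ x₂ ∈ univ.filter (fun x₂ : ↥Λ => R ≤ B5Ineq137Torus.T P j x x₂),
          Aw * Real.exp (-(δ₀ / 16 / M * R)) * Real.exp (-(δ₀ / 16 / M * B5Ineq137Torus.T P j x x₂)) :=
        Finset.sum_le_sum fun x₂ hx₂ => by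
          rw [Finset.mem_filter] at hx₂
          have h := norm_inv_apply_le_walk hγ hc hδ hA hU hM hMR hMθ hθW x x₂
          have hsplit : Real.exp (-(δ₀ / 8) * (B5Ineq137Torus.T P j x.1 x₂.1 / M)) =
              Real.exp (-(δ₀ / 16 / M * B5Ineq137Torus.T P j x x₂)) * Real.exp (-(δ₀ / 16 / M * B5Ineq137Torus.T P j x x₂)) := by
            rw [← Real.exp_add]; congr 1; ring
          rw [hsplit, ← mul_assoc] at h
          refine h.trans (mul_le_mul_of_nonneg_right (mul_le_mul_of_nonneg_left ?_ hK) (Real.exp_pos _).le)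
          exact Real.exp_le_exp.2 (by nlinarith [hx₂.2, ha.le])
    _ = Aw * Real.exp (-(δ₀ / 16 / M * R)) *
          ∑ x₂ ∈ univ.filter (fun x₂ : ↥Λ => R ≤ B5Ineq137Torus.T P j x x₂), Real.exp (-(δ₀ / 16 / M * B5Ineq137Torus.T P j x x₂)) := by
        rw [Finset.mul_sum]
    _ ≤ _ := by
        refine mul_le_mul_of_nonneg_left ?_ (by positivity)
        calc ∑ x₂ ∈ univ.filter (fun x₂ : ↥Λ => R ≤ B5Ineq137Torus.T P j x x₂), Real.exp (-(δ₀ / 16 / M * B5Ineq137Torus.T P j x x₂))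
            ≤ ∑ x₂ : ↥Λ, Real.exp (-(δ₀ / 16 / M * B5Ineq137Torus.T P j x x₂)) :=
              Finset.sum_le_sum_of_subset_of_nonneg (Finset.filter_subset _ _) fun y _ _ => (Real.exp_pos _).le
          _ ≤ _ := (sum_coe_le_sum_univ _ fun y => (Real.exp_pos _).le).trans (B5Ineq137Torus.rowSum_T_le P j ha x)

/-- **(2.47), COMPLEX FORM, ROW-SUMMED**: the local part `C_{Λ,loc}` of (2.43) — p13's primed walk sum `cLoc` on the charted realified `H|_Λ`,
packaged as the complex kernel `K_loc(x₁,x₂) = C_loc((x₁,Re),(x₂,Re)) + i·C_loc((x₁,Im),(x₂,Re))` (p31's convention of `hasSum_walkTerms_inv`;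
ANY kernel equal to it) — is row-wise `ℓ¹`-close to `C_Λ`: `Σ_{x₂}|K_loc(x,x₂) − C_Λ(x,x₂)| ≤ 2δ_{247}K_d(δ₀/(16M))`,
`δ_{247} = 2^dγ₀^{−1}(1−θ_W)^{−1}e^{−(δ₀/16)(ρ−3)}` (p31's `close247_walk`, torus distance `≤` chart distance). [cite: BalabanImbrieJaffe1988, (2.47) p.265] -/
theorem rowSum_cloc_sub_inv_le_walk (hγ : 0 < γ₀) (hc : 0 ≤ c₀) (hδ : 0 < δ₀) (hA : B4.Hyp56 (chartSet Λ) (reOp Λ H) γ₀ c₀ δ₀)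
    (hU : IsUnit (compress Λ H)) {M : ℕ} (hM : 5 ≤ M) (hMR : kR P.d 2 γ₀ c₀ δ₀ < M) (hMθ : thetaConst P.d 2 γ₀ c₀ δ₀ < M)
    (hθW : thetaW P.d 2 γ₀ c₀ δ₀ M < 1) (ρ : ℝ) (Kl : Matrix ↥Λ ↥Λ ℂ)
    (hKl : ∀ x₁ x₂ : ↥Λ, Kl x₁ x₂ =
      ⟨cLoc (ldist (N := 2) M) ρ (fun ω y₁ y₂ => latticeCw M (chartSet Λ) 2 (reOp Λ H) ω y₁ y₂) (idxEquiv Λ (x₁, 0)) (idxEquiv Λ (x₂, 0)),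
       cLoc (ldist (N := 2) M) ρ (fun ω y₁ y₂ => latticeCw M (chartSet Λ) 2 (reOp Λ H) ω y₁ y₂) (idxEquiv Λ (x₁, 1)) (idxEquiv Λ (x₂, 0))⟩)
    (x : ↥Λ) :
    ∑ x₂ : ↥Λ, ‖Kl x x₂ - (compress Λ H)⁻¹ x x₂‖ ≤
      2 * (2 ^ P.d * γ₀⁻¹ * (1 - thetaW P.d 2 γ₀ c₀ δ₀ M)⁻¹ * Real.exp (-(δ₀ / 16 * (ρ - 3)))) * latticeConst P.d (δ₀ / 16 / M) := by
  have hM0 : (0 : ℝ) < M := by exact_mod_cast (show 0 < M by omega)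
  have ha : 0 < δ₀ / 16 / M := by positivity
  have hclose := close247_walk hγ hc hδ hA hU hM hMR hMθ hθW ρ
  set δc := 2 ^ P.d * γ₀⁻¹ * (1 - thetaW P.d 2 γ₀ c₀ δ₀ M)⁻¹ * Real.exp (-(δ₀ / 16 * (ρ - 3))) with hδc
  have hδc0 : 0 ≤ δc := by
    rw [hδc]
    have : 0 < 1 - thetaW P.d 2 γ₀ c₀ δ₀ M := by linarith
    positivity
  have hpt : ∀ x₂ : ↥Λ, ‖Kl x x₂ - (compress Λ H)⁻¹ x x₂‖ ≤ 2 * δc * Real.exp (-(δ₀ / 16 / M * B5Ineq137Torus.T P j x x₂)) := by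
    intro x₂
    have hre := hclose (x, 0) (x₂, 0)
    have him := hclose (x, 1) (x₂, 0)
    dsimp only at hre him
    rw [realify_apply_fst] at hre
    rw [realify_apply_snd] at him
    have hexp : Real.exp (-(δ₀ / 16) * (cdist (x : Balaban1983to89.Site P j) x₂ / M)) ≤
        Real.exp (-(δ₀ / 16 / M * B5Ineq137Torus.T P j x x₂)) :=
      Real.exp_le_exp.2 (by
        have := T_le_cdist (x : Balaban1983to89.Site P j) x₂
        have h' : δ₀ / 16 / M * B5Ineq137Torus.T P j x x₂ ≤ δ₀ / 16 / M * cdist (x : Balaban1983to89.Site P j) x₂ :=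
          mul_le_mul_of_nonneg_left this ha.le
        have h'' : δ₀ / 16 / M * cdist (x : Balaban1983to89.Site P j) x₂ = (δ₀ / 16) * (cdist (x : Balaban1983to89.Site P j) x₂ / M) := by ring
        linarith)
    have hre' : |(Kl x x₂ - (compress Λ H)⁻¹ x x₂).re| ≤ δc * Real.exp (-(δ₀ / 16 / M * B5Ineq137Torus.T P j x x₂)) := by
      rw [Complex.sub_re, hKl]
      exact hre.trans (mul_le_mul_of_nonneg_left hexp hδc0)
    have him' : |(Kl x x₂ - (compress Λ H)⁻¹ x x₂).im| ≤ δc * Real.exp (-(δ₀ / 16 / M * B5Ineq137Torus.T P j x x₂)) := by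
      rw [Complex.sub_im, hKl]
      exact him.trans (mul_le_mul_of_nonneg_left hexp hδc0)
    calc ‖Kl x x₂ - (compress Λ H)⁻¹ x x₂‖ ≤ |(Kl x x₂ - (compress Λ H)⁻¹ x x₂).re| + |(Kl x x₂ - (compress Λ H)⁻¹ x x₂).im| :=
          Complex.norm_le_abs_re_add_abs_im _
      _ ≤ _ := by linarith
  calc ∑ x₂ : ↥Λ, ‖Kl x x₂ - (compress Λ H)⁻¹ x x₂‖ ≤ ∑ x₂ : ↥Λ, 2 * δc * Real.exp (-(δ₀ / 16 / M * B5Ineq137Torus.T P j x x₂)) :=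
        Finset.sum_le_sum fun x₂ _ => hpt x₂
    _ = 2 * δc * ∑ x₂ : ↥Λ, Real.exp (-(δ₀ / 16 / M * B5Ineq137Torus.T P j x x₂)) := by rw [Finset.mul_sum]
    _ ≤ 2 * δc * latticeConst P.d (δ₀ / 16 / M) := by
        refine mul_le_mul_of_nonneg_left ?_ (mul_nonneg zero_le_two hδc0)
        exact (sum_coe_le_sum_univ _ fun y => (Real.exp_pos _).le).trans (B5Ineq137Torus.rowSum_T_le P j ha x)

end Walk


/-! ## §5  (3.33), SCALAR-FIELD HALF: «|φ^{(0)}| ≦ cp(e₀)» -/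

section Main

variable {Λ : Finset (Balaban1983to89.Site P j)}

/-- **(3.33), SCALAR-FIELD HALF, EXPLICIT CONSTANTS** (p. 270 [PDF 14]: *"Similarly, it can be shown that |A^{(0)}| ≦ cp(e₀) in Λ₁^{(0)*},
|φ^{(0)}| ≦ cp(e₀) in Λ₁^{(0)*}, (3.33)"*; mechanism of the general step p. 297 (5.9.5): *"Note that C^{(k)}_{loc}(u_{k+1}) is almost equal to
C^{(k)}(u_{k+1}). Thus we have that in Λ₇^{(k)}, say |φ − a_kL^{−2}C^{(k)}_{loc}(u_{k+1})Q(u_{k+1})*ψ| ≦ O(p(e_k)) (the corresponding statement with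
C^{(k)}(u_{k+1}) was proven in [8, Eq. (2.113)]. … we can replace Q(u_{k+1})*ψ with φ in this bound. This proves that |φ^{(k)}(x)| ≦ cp(e_k),
x ∈ Λ₇^{(k)}. (5.9.5)"*).  THE TREE READING.  `H = D_{u₁}^*D_{u₁} + κQ(u₁)ᴴQ(u₁)` on the unit torus (p31's `nOp κ c U₁ 1 univ`, `κ = aL^{−2}`),
`Λ` a `1`-block union on which the charted realified `H|_Λ` obeys [6] (5.6) (`B4.Hyp56 … γ₀ c₀ δ₀`) with `H|_Λ` invertible and p13's cube-size
conditions (`M ≥ 5`, `M > K_R`, `M > Θ₁`, `θ_W < 1`); `K_loc` = the local part (2.43) of `C_Λ = (H|_Λ)^{−1}` as a complex kernel (p13's primed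
walk sum `cLoc` with radius `ρ` on p31's `reOp Λ H`, packaged `Re + i·Im`; any kernel equal to it).  FIELDS: `|D_{u₁}φ| ≤ p_D` on the bonds
meeting `Λ` and `|ψ − Q(u₁)φ| ≤ p_Q` on the blocks of `Λ` ((3.15)), `|φ| ≤ Φ` on the outer layer of `Λ` and `|ψ| ≤ Ψ` on the blocks of `Λ` (the
`λ₀^{−1/4}p(e₀)` bounds of (3.15)/(3.32)), and the LOCATED MARGIN: every site of `Λ` with a neighbour outside `Λ` is at torus distance `≥ R`
from `x`.  CONCLUSION for the fluctuation field of (3.30) at `x ∈ Λ`, `φ^{(0)}(x) = φ(x) − κ(K_locQ(u₁)ᴴψ)(x)`: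
`|φ^{(0)}(x)| ≤ A_wK_d(δ₀/8M)(2d|c|p_D + κL^{−d}p_Q) + A_we^{−(δ₀/16M)R}K_d(δ₀/16M)·2dc²Φ + κ·2δ_{247}K_d(δ₀/16M)L^{−d}Ψ`,
`A_w = 2·2^dγ₀^{−1}(1−θ_W)^{−1}e^{δ₀/4}`, `δ_{247} = 2^dγ₀^{−1}(1−θ_W)^{−1}e^{−(δ₀/16)(ρ−3)}`, `K_d` = pv23's `latticeConst` — uniform in the
volume. [cite: BalabanImbrieJaffe1988, (3.33) p.270] -/
theorem small333_scalar {κ c : ℝ} (hκ : 0 ≤ κ) (U : GaugeField P j U1) (hΛ : BIJ88NeumannNoZeroModesTorus.IsBlockUnion 1 Λ)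
    {γ₀ c₀ δ₀ : ℝ} (hγ : 0 < γ₀) (hc : 0 ≤ c₀) (hδ : 0 < δ₀) (hA : B4.Hyp56 (chartSet Λ) (reOp Λ (nOp κ c U 1 univ)) γ₀ c₀ δ₀)
    (hU : IsUnit (compress Λ (nOp κ c U 1 univ))) {M : ℕ} (hM : 5 ≤ M) (hMR : kR P.d 2 γ₀ c₀ δ₀ < M) (hMθ : thetaConst P.d 2 γ₀ c₀ δ₀ < M)
    (hθW : thetaW P.d 2 γ₀ c₀ δ₀ M < 1) (ρ : ℝ) (Kl : Matrix ↥Λ ↥Λ ℂ)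
    (hKl : ∀ x₁ x₂ : ↥Λ, Kl x₁ x₂ =
      ⟨cLoc (ldist (N := 2) M) ρ (fun ω y₁ y₂ => latticeCw M (chartSet Λ) 2 (reOp Λ (nOp κ c U 1 univ)) ω y₁ y₂)
          (idxEquiv Λ (x₁, 0)) (idxEquiv Λ (x₂, 0)),
       cLoc (ldist (N := 2) M) ρ (fun ω y₁ y₂ => latticeCw M (chartSet Λ) 2 (reOp Λ (nOp κ c U 1 univ)) ω y₁ y₂)
          (idxEquiv Λ (x₁, 1)) (idxEquiv Λ (x₂, 0))⟩)
    {φ : Balaban1983to89.Site P j → ℂ} {ψ : Balaban1983to89.Site P (j + 1) → ℂ} {pD pQ Φ Ψ R : ℝ} (hΦ0 : 0 ≤ Φ)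
    (hD : ∀ b : PBond P j, (b.src ∈ Λ ∨ b.tgt ∈ Λ) → ‖covD c (cfg U) φ b‖ ≤ pD)
    (hQ : ∀ y : Balaban1983to89.Site P (j + 1), blockK 1 y ⊆ Λ → ‖ψ y - (qMatT U 1 *ᵥ φ) y‖ ≤ pQ)
    (hΦ : ∀ b : PBond P j, (b.src ∈ Λ → b.tgt ∉ Λ → ‖φ b.tgt‖ ≤ Φ) ∧ (b.tgt ∈ Λ → b.src ∉ Λ → ‖φ b.src‖ ≤ Φ))
    (hΨ : ∀ y : Balaban1983to89.Site P (j + 1), blockK 1 y ⊆ Λ → ‖ψ y‖ ≤ Ψ) (x : ↥Λ)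
    (hR : ∀ x₂ ∈ Λ, (∃ μ : Fin P.d, x₂.shift μ ∉ Λ ∨ x₂.unshift μ ∉ Λ) → R ≤ B5Ineq137Torus.T P j x x₂) :
    ‖φ x - (κ : ℂ) * (Kl *ᵥ fun x₂ : ↥Λ => ((qMatT U 1)ᴴ *ᵥ ψ) x₂) x‖ ≤
      2 * (2 ^ P.d * γ₀⁻¹ * (1 - thetaW P.d 2 γ₀ c₀ δ₀ M)⁻¹ * Real.exp (δ₀ / 4)) * latticeConst P.d (δ₀ / 8 / M)
          * (|c| * (2 * P.d) * pD + κ * ((P.L : ℝ) ^ P.d)⁻¹ * pQ)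
        + 2 * (2 ^ P.d * γ₀⁻¹ * (1 - thetaW P.d 2 γ₀ c₀ δ₀ M)⁻¹ * Real.exp (δ₀ / 4)) * Real.exp (-(δ₀ / 16 / M * R))
          * latticeConst P.d (δ₀ / 16 / M) * (|c| * (2 * P.d) * (|c| * Φ))
        + κ * (2 * (2 ^ P.d * γ₀⁻¹ * (1 - thetaW P.d 2 γ₀ c₀ δ₀ M)⁻¹ * Real.exp (-(δ₀ / 16 * (ρ - 3)))) * latticeConst P.d (δ₀ / 16 / M)
          * (((P.L : ℝ) ^ P.d)⁻¹ * Ψ)) :=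
  norm_phi0_le_abstract hκ U hΛ hU hΦ0 hD hQ hΦ hΨ x hR (rowSum_inv_le_walk hγ hc hδ hA hU hM hMR hMθ hθW x)
    (tailSum_inv_le_walk hγ hc hδ hA hU hM hMR hMθ hθW x R) Kl (rowSum_cloc_sub_inv_le_walk hγ hc hδ hA hU hM hMR hMθ hθW ρ Kl hKl x)

/-- **(3.33), SCALAR-FIELD HALF, AS PRINTED: `|φ^{(0)}(x)| ≤ c·p(e₀)`** once the inputs are measured in `p = p(e₀)`: `p_D, p_Q ≤ c₁p`
((3.15) transferred to `u₁`), and the REGIME inequalities `e^{−(δ₀/16M)R}Φ ≤ p` (the margin `R ~ r(e₀)` beats the `λ₀^{−1/4}` of `Φ`) and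
`δ_{247}Ψ ≤ p` (the (2.47) smallness `e^{−cr(e₀)}` beats the `λ₀^{−1/4}` of `Ψ`); the constant
`c = A_wK_d(δ₀/8M)(2d|c| + κL^{−d})c₁ + A_wK_d(δ₀/16M)·2dc² + 2κK_d(δ₀/16M)L^{−d}` depends on `(d, L, κ, c)` and the walk constants only.
[cite: BalabanImbrieJaffe1988, (3.33) p.270] -/
theorem small333_scalar_of_regime {κ c : ℝ} (hκ : 0 ≤ κ) (U : GaugeField P j U1) (hΛ : BIJ88NeumannNoZeroModesTorus.IsBlockUnion 1 Λ)
    {γ₀ c₀ δ₀ : ℝ} (hγ : 0 < γ₀) (hc : 0 ≤ c₀) (hδ : 0 < δ₀) (hA : B4.Hyp56 (chartSet Λ) (reOp Λ (nOp κ c U 1 univ)) γ₀ c₀ δ₀)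
    (hU : IsUnit (compress Λ (nOp κ c U 1 univ))) {M : ℕ} (hM : 5 ≤ M) (hMR : kR P.d 2 γ₀ c₀ δ₀ < M) (hMθ : thetaConst P.d 2 γ₀ c₀ δ₀ < M)
    (hθW : thetaW P.d 2 γ₀ c₀ δ₀ M < 1) (ρ : ℝ) (Kl : Matrix ↥Λ ↥Λ ℂ)
    (hKl : ∀ x₁ x₂ : ↥Λ, Kl x₁ x₂ =
      ⟨cLoc (ldist (N := 2) M) ρ (fun ω y₁ y₂ => latticeCw M (chartSet Λ) 2 (reOp Λ (nOp κ c U 1 univ)) ω y₁ y₂)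
          (idxEquiv Λ (x₁, 0)) (idxEquiv Λ (x₂, 0)),
       cLoc (ldist (N := 2) M) ρ (fun ω y₁ y₂ => latticeCw M (chartSet Λ) 2 (reOp Λ (nOp κ c U 1 univ)) ω y₁ y₂)
          (idxEquiv Λ (x₁, 1)) (idxEquiv Λ (x₂, 0))⟩)
    {φ : Balaban1983to89.Site P j → ℂ} {ψ : Balaban1983to89.Site P (j + 1) → ℂ} {pD pQ Φ Ψ R p c₁ : ℝ} (hΦ0 : 0 ≤ Φ)
    (hD : ∀ b : PBond P j, (b.src ∈ Λ ∨ b.tgt ∈ Λ) → ‖covD c (cfg U) φ b‖ ≤ pD)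
    (hQ : ∀ y : Balaban1983to89.Site P (j + 1), blockK 1 y ⊆ Λ → ‖ψ y - (qMatT U 1 *ᵥ φ) y‖ ≤ pQ)
    (hΦ : ∀ b : PBond P j, (b.src ∈ Λ → b.tgt ∉ Λ → ‖φ b.tgt‖ ≤ Φ) ∧ (b.tgt ∈ Λ → b.src ∉ Λ → ‖φ b.src‖ ≤ Φ))
    (hΨ : ∀ y : Balaban1983to89.Site P (j + 1), blockK 1 y ⊆ Λ → ‖ψ y‖ ≤ Ψ) (x : ↥Λ)
    (hR : ∀ x₂ ∈ Λ, (∃ μ : Fin P.d, x₂.shift μ ∉ Λ ∨ x₂.unshift μ ∉ Λ) → R ≤ B5Ineq137Torus.T P j x x₂)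
    (hpD : pD ≤ c₁ * p) (hpQ : pQ ≤ c₁ * p) (hRΦ : Real.exp (-(δ₀ / 16 / M * R)) * Φ ≤ p)
    (hδΨ : 2 ^ P.d * γ₀⁻¹ * (1 - thetaW P.d 2 γ₀ c₀ δ₀ M)⁻¹ * Real.exp (-(δ₀ / 16 * (ρ - 3))) * Ψ ≤ p) :
    ‖φ x - (κ : ℂ) * (Kl *ᵥ fun x₂ : ↥Λ => ((qMatT U 1)ᴴ *ᵥ ψ) x₂) x‖ ≤
      (2 * (2 ^ P.d * γ₀⁻¹ * (1 - thetaW P.d 2 γ₀ c₀ δ₀ M)⁻¹ * Real.exp (δ₀ / 4)) * latticeConst P.d (δ₀ / 8 / M)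
            * (|c| * (2 * P.d) + κ * ((P.L : ℝ) ^ P.d)⁻¹) * c₁
        + 2 * (2 ^ P.d * γ₀⁻¹ * (1 - thetaW P.d 2 γ₀ c₀ δ₀ M)⁻¹ * Real.exp (δ₀ / 4)) * latticeConst P.d (δ₀ / 16 / M)
            * (|c| * (2 * P.d) * |c|)
        + κ * 2 * latticeConst P.d (δ₀ / 16 / M) * ((P.L : ℝ) ^ P.d)⁻¹) * p := by
  have hM0 : (0 : ℝ) < M := by exact_mod_cast (show 0 < M by omega)
  have hθ : 0 < 1 - thetaW P.d 2 γ₀ c₀ δ₀ M := by linarith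
  set Aw := 2 * (2 ^ P.d * γ₀⁻¹ * (1 - thetaW P.d 2 γ₀ c₀ δ₀ M)⁻¹ * Real.exp (δ₀ / 4)) with hAw
  set δc := 2 ^ P.d * γ₀⁻¹ * (1 - thetaW P.d 2 γ₀ c₀ δ₀ M)⁻¹ * Real.exp (-(δ₀ / 16 * (ρ - 3))) with hδc
  set K8 := latticeConst P.d (δ₀ / 8 / M) with hK8
  set K16 := latticeConst P.d (δ₀ / 16 / M) with hK16
  have hAw0 : 0 ≤ Aw := by rw [hAw]; positivity
  have hK80 : 0 ≤ K8 := latticeConst_nonneg _ (by positivity)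
  have hK160 : 0 ≤ K16 := latticeConst_nonneg _ (by positivity)
  have hLd : 0 ≤ ((P.L : ℝ) ^ P.d)⁻¹ := by positivity
  have h := small333_scalar hκ U hΛ hγ hc hδ hA hU hM hMR hMθ hθW ρ Kl hKl hΦ0 hD hQ hΦ hΨ x hR
  have h1 : Aw * K8 * (|c| * (2 * P.d) * pD + κ * ((P.L : ℝ) ^ P.d)⁻¹ * pQ) ≤
      Aw * K8 * (|c| * (2 * P.d) + κ * ((P.L : ℝ) ^ P.d)⁻¹) * c₁ * p := by
    have e1 : |c| * (2 * P.d) * pD ≤ |c| * (2 * P.d) * (c₁ * p) := mul_le_mul_of_nonneg_left hpD (by positivity)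
    have e2 : κ * ((P.L : ℝ) ^ P.d)⁻¹ * pQ ≤ κ * ((P.L : ℝ) ^ P.d)⁻¹ * (c₁ * p) := mul_le_mul_of_nonneg_left hpQ (by positivity)
    have e3 := mul_le_mul_of_nonneg_left (add_le_add e1 e2) (mul_nonneg hAw0 hK80)
    refine e3.trans (le_of_eq ?_)
    ring
  have h2 : Aw * Real.exp (-(δ₀ / 16 / M * R)) * K16 * (|c| * (2 * P.d) * (|c| * Φ)) ≤ Aw * K16 * (|c| * (2 * P.d) * |c|) * p := by
    have e1 := mul_le_mul_of_nonneg_left hRΦ (show 0 ≤ Aw * K16 * (|c| * (2 * P.d) * |c|) by positivity)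
    refine (le_of_eq ?_).trans (e1.trans (le_of_eq ?_)) <;> ring
  have h3 : κ * (2 * δc * K16 * (((P.L : ℝ) ^ P.d)⁻¹ * Ψ)) ≤ κ * 2 * K16 * ((P.L : ℝ) ^ P.d)⁻¹ * p := by
    have e1 := mul_le_mul_of_nonneg_left hδΨ (show 0 ≤ κ * 2 * K16 * ((P.L : ℝ) ^ P.d)⁻¹ by positivity)
    refine (le_of_eq ?_).trans (e1.trans (le_of_eq ?_)) <;> ring
  refine h.trans ?_
  calc _ ≤ Aw * K8 * (|c| * (2 * P.d) + κ * ((P.L : ℝ) ^ P.d)⁻¹) * c₁ * p + Aw * K16 * (|c| * (2 * P.d) * |c|) * p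
        + κ * 2 * K16 * ((P.L : ℝ) ^ P.d)⁻¹ * p := add_le_add (add_le_add h1 h2) h3
    _ = _ := by ring

/-- **(3.33), SCALAR-FIELD HALF, READ ON r18's TYPED (3.30)** `BIJ88Sect3Translations.phi330`
(`φ = φ^{(0)} + aL^{−2}Λ₇^{(0)}·corr`): if the correction `corr` of (3.30) is, on the sites of `Λ₇ ∩ Λ`, the local scalar correction
`C^{(0)}_{Λ,loc}(u₁)Q(u₁)ᴴψ` (`K_locQ(u₁)ᴴψ`, as in `small333_scalar`; p29 g34's `corr330`), then at every `x ∈ Λ₇ ∩ Λ` with the located margin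
`R` the NEW field `φ^{(0)}` obeys the bound of `small333_scalar` at `κ = aL^{−2}` — the second clause of r18's `BIJ88Sect3Statements.Small333` at
the site `x`, modulo the regime inequalities of `small333_scalar_of_regime`. [cite: BalabanImbrieJaffe1988, (3.33) p.270] -/
theorem small333_scalar_phi330 {a L c : ℝ} (haL : 0 ≤ a * L ^ (-(2 : ℤ))) (U : GaugeField P j U1)
    (hΛ : BIJ88NeumannNoZeroModesTorus.IsBlockUnion 1 Λ) {γ₀ c₀ δ₀ : ℝ} (hγ : 0 < γ₀) (hc : 0 ≤ c₀) (hδ : 0 < δ₀)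
    (hA : B4.Hyp56 (chartSet Λ) (reOp Λ (nOp (a * L ^ (-(2 : ℤ))) c U 1 univ)) γ₀ c₀ δ₀)
    (hU : IsUnit (compress Λ (nOp (a * L ^ (-(2 : ℤ))) c U 1 univ))) {M : ℕ} (hM : 5 ≤ M) (hMR : kR P.d 2 γ₀ c₀ δ₀ < M)
    (hMθ : thetaConst P.d 2 γ₀ c₀ δ₀ < M) (hθW : thetaW P.d 2 γ₀ c₀ δ₀ M < 1) (ρ : ℝ) (Kl : Matrix ↥Λ ↥Λ ℂ)
    (hKl : ∀ x₁ x₂ : ↥Λ, Kl x₁ x₂ =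
      ⟨cLoc (ldist (N := 2) M) ρ (fun ω y₁ y₂ => latticeCw M (chartSet Λ) 2 (reOp Λ (nOp (a * L ^ (-(2 : ℤ))) c U 1 univ)) ω y₁ y₂)
          (idxEquiv Λ (x₁, 0)) (idxEquiv Λ (x₂, 0)),
       cLoc (ldist (N := 2) M) ρ (fun ω y₁ y₂ => latticeCw M (chartSet Λ) 2 (reOp Λ (nOp (a * L ^ (-(2 : ℤ))) c U 1 univ)) ω y₁ y₂)
          (idxEquiv Λ (x₁, 1)) (idxEquiv Λ (x₂, 0))⟩)
    {φ φ0 corr : Balaban1983to89.Site P j → ℂ} {ψ : Balaban1983to89.Site P (j + 1) → ℂ} {Λ₇ : Finset (Balaban1983to89.Site P j)}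
    (hφ : φ = BIJ88Sect3Translations.phi330 Λ₇ a L φ0 corr)
    (hcorr : ∀ x₂ : ↥Λ, (x₂ : Balaban1983to89.Site P j) ∈ Λ₇ → corr x₂ = (Kl *ᵥ fun x₃ : ↥Λ => ((qMatT U 1)ᴴ *ᵥ ψ) x₃) x₂)
    {pD pQ Φ Ψ R : ℝ} (hΦ0 : 0 ≤ Φ)
    (hD : ∀ b : PBond P j, (b.src ∈ Λ ∨ b.tgt ∈ Λ) → ‖covD c (cfg U) φ b‖ ≤ pD)
    (hQ : ∀ y : Balaban1983to89.Site P (j + 1), blockK 1 y ⊆ Λ → ‖ψ y - (qMatT U 1 *ᵥ φ) y‖ ≤ pQ)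
    (hΦ : ∀ b : PBond P j, (b.src ∈ Λ → b.tgt ∉ Λ → ‖φ b.tgt‖ ≤ Φ) ∧ (b.tgt ∈ Λ → b.src ∉ Λ → ‖φ b.src‖ ≤ Φ))
    (hΨ : ∀ y : Balaban1983to89.Site P (j + 1), blockK 1 y ⊆ Λ → ‖ψ y‖ ≤ Ψ) (x : ↥Λ) (hx : (x : Balaban1983to89.Site P j) ∈ Λ₇)
    (hR : ∀ x₂ ∈ Λ, (∃ μ : Fin P.d, x₂.shift μ ∉ Λ ∨ x₂.unshift μ ∉ Λ) → R ≤ B5Ineq137Torus.T P j x x₂) :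
    ‖φ0 x‖ ≤
      2 * (2 ^ P.d * γ₀⁻¹ * (1 - thetaW P.d 2 γ₀ c₀ δ₀ M)⁻¹ * Real.exp (δ₀ / 4)) * latticeConst P.d (δ₀ / 8 / M)
          * (|c| * (2 * P.d) * pD + a * L ^ (-(2 : ℤ)) * ((P.L : ℝ) ^ P.d)⁻¹ * pQ)
        + 2 * (2 ^ P.d * γ₀⁻¹ * (1 - thetaW P.d 2 γ₀ c₀ δ₀ M)⁻¹ * Real.exp (δ₀ / 4)) * Real.exp (-(δ₀ / 16 / M * R))
          * latticeConst P.d (δ₀ / 16 / M) * (|c| * (2 * P.d) * (|c| * Φ))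
        + a * L ^ (-(2 : ℤ)) * (2 * (2 ^ P.d * γ₀⁻¹ * (1 - thetaW P.d 2 γ₀ c₀ δ₀ M)⁻¹ * Real.exp (-(δ₀ / 16 * (ρ - 3))))
          * latticeConst P.d (δ₀ / 16 / M) * (((P.L : ℝ) ^ P.d)⁻¹ * Ψ)) := by
  have hφx : φ0 x = φ x - ((a * L ^ (-(2 : ℤ)) : ℝ) : ℂ) * (Kl *ᵥ fun x₃ : ↥Λ => ((qMatT U 1)ᴴ *ᵥ ψ) x₃) x := by
    rw [hφ, BIJ88Sect3Translations.phi330, if_pos hx, hcorr x hx, add_sub_cancel_right]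
  rw [hφx]
  exact small333_scalar haL U hΛ hγ hc hδ hA hU hM hMR hMθ hθW ρ Kl hKl hΦ0 hD hQ hΦ hΨ x hR

/-- **(3.33), SCALAR-FIELD HALF, ON THE REGION `Λ₇` — the shape of the second conjunct of r18's `BIJ88Sect3Statements.Small333`**
(`∀ x ∈ Λ₇, ‖φ^{(0)} x‖ ≤ c·p(e₀)`; print: *"we inset a factor χ′_{Λ₇^{(0)}} enforcing these bounds in Λ₇^{(0)}"*): for `Λ₇ ⊆ Λ` whose every
site has the located margin `R` to the boundary layer of `Λ` (print: the regions `Λ_i^{(0)}` arise *"by deleting r(e₀)-cubes at the boundary"*,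
p. 267), the field `φ^{(0)}` of r18's (3.30) `phi330` with the local scalar correction obeys `‖φ^{(0)}(x)‖ ≤ c·p` on `Λ₇` under the regime
inequalities of `small333_scalar_of_regime`. [cite: BalabanImbrieJaffe1988, (3.33) p.270] -/
theorem small333_scalar_phi330_region {a L c : ℝ} (haL : 0 ≤ a * L ^ (-(2 : ℤ))) (U : GaugeField P j U1)
    (hΛ : BIJ88NeumannNoZeroModesTorus.IsBlockUnion 1 Λ) {γ₀ c₀ δ₀ : ℝ} (hγ : 0 < γ₀) (hc : 0 ≤ c₀) (hδ : 0 < δ₀)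
    (hA : B4.Hyp56 (chartSet Λ) (reOp Λ (nOp (a * L ^ (-(2 : ℤ))) c U 1 univ)) γ₀ c₀ δ₀)
    (hU : IsUnit (compress Λ (nOp (a * L ^ (-(2 : ℤ))) c U 1 univ))) {M : ℕ} (hM : 5 ≤ M) (hMR : kR P.d 2 γ₀ c₀ δ₀ < M)
    (hMθ : thetaConst P.d 2 γ₀ c₀ δ₀ < M) (hθW : thetaW P.d 2 γ₀ c₀ δ₀ M < 1) (ρ : ℝ) (Kl : Matrix ↥Λ ↥Λ ℂ)
    (hKl : ∀ x₁ x₂ : ↥Λ, Kl x₁ x₂ =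
      ⟨cLoc (ldist (N := 2) M) ρ (fun ω y₁ y₂ => latticeCw M (chartSet Λ) 2 (reOp Λ (nOp (a * L ^ (-(2 : ℤ))) c U 1 univ)) ω y₁ y₂)
          (idxEquiv Λ (x₁, 0)) (idxEquiv Λ (x₂, 0)),
       cLoc (ldist (N := 2) M) ρ (fun ω y₁ y₂ => latticeCw M (chartSet Λ) 2 (reOp Λ (nOp (a * L ^ (-(2 : ℤ))) c U 1 univ)) ω y₁ y₂)
          (idxEquiv Λ (x₁, 1)) (idxEquiv Λ (x₂, 0))⟩)
    {φ φ0 corr : Balaban1983to89.Site P j → ℂ} {ψ : Balaban1983to89.Site P (j + 1) → ℂ} {Λ₇ : Finset (Balaban1983to89.Site P j)}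
    (h7 : Λ₇ ⊆ Λ) (hφ : φ = BIJ88Sect3Translations.phi330 Λ₇ a L φ0 corr)
    (hcorr : ∀ x₂ : ↥Λ, (x₂ : Balaban1983to89.Site P j) ∈ Λ₇ → corr x₂ = (Kl *ᵥ fun x₃ : ↥Λ => ((qMatT U 1)ᴴ *ᵥ ψ) x₃) x₂)
    {pD pQ Φ Ψ R p c₁ : ℝ} (hΦ0 : 0 ≤ Φ)
    (hD : ∀ b : PBond P j, (b.src ∈ Λ ∨ b.tgt ∈ Λ) → ‖covD c (cfg U) φ b‖ ≤ pD)
    (hQ : ∀ y : Balaban1983to89.Site P (j + 1), blockK 1 y ⊆ Λ → ‖ψ y - (qMatT U 1 *ᵥ φ) y‖ ≤ pQ)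
    (hΦ : ∀ b : PBond P j, (b.src ∈ Λ → b.tgt ∉ Λ → ‖φ b.tgt‖ ≤ Φ) ∧ (b.tgt ∈ Λ → b.src ∉ Λ → ‖φ b.src‖ ≤ Φ))
    (hΨ : ∀ y : Balaban1983to89.Site P (j + 1), blockK 1 y ⊆ Λ → ‖ψ y‖ ≤ Ψ)
    (hR : ∀ x ∈ Λ₇, ∀ x₂ ∈ Λ, (∃ μ : Fin P.d, x₂.shift μ ∉ Λ ∨ x₂.unshift μ ∉ Λ) → R ≤ B5Ineq137Torus.T P j x x₂)
    (hpD : pD ≤ c₁ * p) (hpQ : pQ ≤ c₁ * p) (hRΦ : Real.exp (-(δ₀ / 16 / M * R)) * Φ ≤ p)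
    (hδΨ : 2 ^ P.d * γ₀⁻¹ * (1 - thetaW P.d 2 γ₀ c₀ δ₀ M)⁻¹ * Real.exp (-(δ₀ / 16 * (ρ - 3))) * Ψ ≤ p) :
    ∀ x ∈ Λ₇, ‖φ0 x‖ ≤
      (2 * (2 ^ P.d * γ₀⁻¹ * (1 - thetaW P.d 2 γ₀ c₀ δ₀ M)⁻¹ * Real.exp (δ₀ / 4)) * latticeConst P.d (δ₀ / 8 / M)
            * (|c| * (2 * P.d) + a * L ^ (-(2 : ℤ)) * ((P.L : ℝ) ^ P.d)⁻¹) * c₁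
        + 2 * (2 ^ P.d * γ₀⁻¹ * (1 - thetaW P.d 2 γ₀ c₀ δ₀ M)⁻¹ * Real.exp (δ₀ / 4)) * latticeConst P.d (δ₀ / 16 / M)
            * (|c| * (2 * P.d) * |c|)
        + a * L ^ (-(2 : ℤ)) * 2 * latticeConst P.d (δ₀ / 16 / M) * ((P.L : ℝ) ^ P.d)⁻¹) * p := by
  intro x hx
  have hφx : φ0 x = φ x - ((a * L ^ (-(2 : ℤ)) : ℝ) : ℂ) * (Kl *ᵥ fun x₃ : ↥Λ => ((qMatT U 1)ᴴ *ᵥ ψ) x₃) ⟨x, h7 hx⟩ := by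
    rw [hφ, BIJ88Sect3Translations.phi330, if_pos hx, hcorr ⟨x, h7 hx⟩ hx, add_sub_cancel_right]
  rw [hφx]
  exact small333_scalar_of_regime haL U hΛ hγ hc hδ hA hU hM hMR hMθ hθW ρ Kl hKl hΦ0 hD hQ hΦ hΨ ⟨x, h7 hx⟩ (hR x hx) hpD hpQ hRΦ hδΨ

/-- **(3.33), SCALAR-FIELD HALF, FROM r18's TYPED (3.15) AND (3.32)** (`BIJ88Sect3Statements.SmallField315` read AT THE BACKGROUND `u₁` —
print p. 297: *"Using arguments like the ones we used to bound D_{ū_{k+1}}ψ, we can replace Q(u_{k+1})*ψ with φ"*; the transfer of (3.15) from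
`u` to `u₁ = ue^{−ie₀A^{(0)}}` on `Λ₄* ∩ Λ₆*` is NOT re-derived here — and `BIJ88Sect3Statements.SmallBlock332` for `|ψ| ≦ cp(e₀)λ₀^{−1/4}`): if
the small-field region `Λ₀` contains `Λ` with one layer of sites and the blocks of `Λ` are blocks of `Λ₀′`, then on `Λ₇ ⊆ Λ` (located margin
`R`) **`‖φ^{(0)}(x)‖ ≤ c·p(e₀)`**, `c = A_wK_d(δ₀/8M)(2d|c| + aL^{−2}L^{−d}) + A_wK_d(δ₀/16M)·2dc² + 2aL^{−2}K_d(δ₀/16M)L^{−d}`, under the two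
REGIME inequalities `e^{−(δ₀/16M)R}λ₀^{−1/4} ≤ 1` and `δ_{247}·c′λ₀^{−1/4} ≤ 1` (print: `r(e₀) → ∞`, the (2.47) defect is `e^{−cr(e₀)}`).
[cite: BalabanImbrieJaffe1988, (3.33) p.270] -/
theorem small333_scalar_of_smallField315 {a L c : ℝ} (haL : 0 ≤ a * L ^ (-(2 : ℤ))) (U : GaugeField P j U1)
    (hΛ : BIJ88NeumannNoZeroModesTorus.IsBlockUnion 1 Λ) {γ₀ c₀ δ₀ : ℝ} (hγ : 0 < γ₀) (hc : 0 ≤ c₀) (hδ : 0 < δ₀)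
    (hA : B4.Hyp56 (chartSet Λ) (reOp Λ (nOp (a * L ^ (-(2 : ℤ))) c U 1 univ)) γ₀ c₀ δ₀)
    (hU : IsUnit (compress Λ (nOp (a * L ^ (-(2 : ℤ))) c U 1 univ))) {M : ℕ} (hM : 5 ≤ M) (hMR : kR P.d 2 γ₀ c₀ δ₀ < M)
    (hMθ : thetaConst P.d 2 γ₀ c₀ δ₀ < M) (hθW : thetaW P.d 2 γ₀ c₀ δ₀ M < 1) (ρ : ℝ) (Kl : Matrix ↥Λ ↥Λ ℂ)
    (hKl : ∀ x₁ x₂ : ↥Λ, Kl x₁ x₂ =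
      ⟨cLoc (ldist (N := 2) M) ρ (fun ω y₁ y₂ => latticeCw M (chartSet Λ) 2 (reOp Λ (nOp (a * L ^ (-(2 : ℤ))) c U 1 univ)) ω y₁ y₂)
          (idxEquiv Λ (x₁, 0)) (idxEquiv Λ (x₂, 0)),
       cLoc (ldist (N := 2) M) ρ (fun ω y₁ y₂ => latticeCw M (chartSet Λ) 2 (reOp Λ (nOp (a * L ^ (-(2 : ℤ))) c U 1 univ)) ω y₁ y₂)
          (idxEquiv Λ (x₁, 1)) (idxEquiv Λ (x₂, 0))⟩)
    {φ φ0 corr : Balaban1983to89.Site P j → ℂ} {ψ : Balaban1983to89.Site P (j + 1) → ℂ} {Λ₇ : Finset (Balaban1983to89.Site P j)}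
    (h7 : Λ₇ ⊆ Λ) (hφ : φ = BIJ88Sect3Translations.phi330 Λ₇ a L φ0 corr)
    (hcorr : ∀ x₂ : ↥Λ, (x₂ : Balaban1983to89.Site P j) ∈ Λ₇ → corr x₂ = (Kl *ᵥ fun x₃ : ↥Λ => ((qMatT U 1)ᴴ *ᵥ ψ) x₃) x₂)
    {Λ₀ : Finset (Balaban1983to89.Site P j)} {Λ₀' : Finset (Balaban1983to89.Site P (j + 1))} {pe₀ lam₀ c' e₀ R : ℝ} (hpe : 0 ≤ pe₀)
    (hlam : 0 ≤ lam₀) {f0 : Balaban1983to89.Plaq P j → ℝ} {v : Balaban1983to89.Plaq P (j + 1) → ℂ} {Dψ : PBond P (j + 1) → ℂ}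
    (h315 : BIJ88Sect3Statements.SmallField315 pe₀ lam₀ Λ₀ Λ₀' (covD c (cfg U) φ) ψ (qMatT U 1 *ᵥ φ) φ f0)
    (h332 : BIJ88Sect3Statements.SmallBlock332 c' e₀ pe₀ lam₀ Λ₀' v ψ Dψ)
    (hB : ∀ b : PBond P j, (b.src ∈ Λ ∨ b.tgt ∈ Λ) → b ∈ BIJ88Sect3Statements.starB Λ₀)
    (hY : ∀ y : Balaban1983to89.Site P (j + 1), blockK 1 y ⊆ Λ → y ∈ Λ₀')
    (hR : ∀ x ∈ Λ₇, ∀ x₂ ∈ Λ, (∃ μ : Fin P.d, x₂.shift μ ∉ Λ ∨ x₂.unshift μ ∉ Λ) → R ≤ B5Ineq137Torus.T P j x x₂)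
    (hRlam : Real.exp (-(δ₀ / 16 / M * R)) * lam₀ ^ (-(1 / 4 : ℝ)) ≤ 1)
    (hδlam : 2 ^ P.d * γ₀⁻¹ * (1 - thetaW P.d 2 γ₀ c₀ δ₀ M)⁻¹ * Real.exp (-(δ₀ / 16 * (ρ - 3))) * (c' * lam₀ ^ (-(1 / 4 : ℝ))) ≤ 1) :
    ∀ x ∈ Λ₇, ‖φ0 x‖ ≤
      (2 * (2 ^ P.d * γ₀⁻¹ * (1 - thetaW P.d 2 γ₀ c₀ δ₀ M)⁻¹ * Real.exp (δ₀ / 4)) * latticeConst P.d (δ₀ / 8 / M)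
            * (|c| * (2 * P.d) + a * L ^ (-(2 : ℤ)) * ((P.L : ℝ) ^ P.d)⁻¹) * 1
        + 2 * (2 ^ P.d * γ₀⁻¹ * (1 - thetaW P.d 2 γ₀ c₀ δ₀ M)⁻¹ * Real.exp (δ₀ / 4)) * latticeConst P.d (δ₀ / 16 / M)
            * (|c| * (2 * P.d) * |c|)
        + a * L ^ (-(2 : ℤ)) * 2 * latticeConst P.d (δ₀ / 16 / M) * ((P.L : ℝ) ^ P.d)⁻¹) * pe₀ := by
  obtain ⟨hD0, hQ0, hφ0, -⟩ := h315
  obtain ⟨-, hψ0, -⟩ := h332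
  have hlq : 0 ≤ lam₀ ^ (-(1 / 4 : ℝ)) := Real.rpow_nonneg hlam _
  have hout : ∀ b : PBond P j, (b.src ∈ Λ → b.tgt ∉ Λ → ‖φ b.tgt‖ ≤ lam₀ ^ (-(1 / 4 : ℝ)) * pe₀) ∧
      (b.tgt ∈ Λ → b.src ∉ Λ → ‖φ b.src‖ ≤ lam₀ ^ (-(1 / 4 : ℝ)) * pe₀) := fun b =>
    ⟨fun hs _ => hφ0 _ ((BIJ88Sect3Statements.mem_starB _ _).1 (hB b (Or.inl hs))).2,
     fun ht _ => hφ0 _ ((BIJ88Sect3Statements.mem_starB _ _).1 (hB b (Or.inr ht))).1⟩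
  refine small333_scalar_phi330_region haL U hΛ hγ hc hδ hA hU hM hMR hMθ hθW ρ Kl hKl h7 hφ hcorr (by positivity)
    (fun b hb => hD0 b (hB b hb)) (fun y hy => hQ0 y (hY y hy)) hout (fun y hy => hψ0 y (hY y hy)) hR
    (by rw [one_mul]) (by rw [one_mul]) ?_ ?_
  · calc Real.exp (-(δ₀ / 16 / M * R)) * (lam₀ ^ (-(1 / 4 : ℝ)) * pe₀)
        = Real.exp (-(δ₀ / 16 / M * R)) * lam₀ ^ (-(1 / 4 : ℝ)) * pe₀ := by ring
      _ ≤ 1 * pe₀ := mul_le_mul_of_nonneg_right hRlam hpe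
      _ = pe₀ := one_mul _
  · calc 2 ^ P.d * γ₀⁻¹ * (1 - thetaW P.d 2 γ₀ c₀ δ₀ M)⁻¹ * Real.exp (-(δ₀ / 16 * (ρ - 3))) * (c' * pe₀ * lam₀ ^ (-(1 / 4 : ℝ)))
        = 2 ^ P.d * γ₀⁻¹ * (1 - thetaW P.d 2 γ₀ c₀ δ₀ M)⁻¹ * Real.exp (-(δ₀ / 16 * (ρ - 3))) * (c' * lam₀ ^ (-(1 / 4 : ℝ))) * pe₀ := by
          ring
      _ ≤ 1 * pe₀ := mul_le_mul_of_nonneg_right hδlam hpe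
      _ = pe₀ := one_mul _

/-- kernel: a full-lattice kernel vanishing off `Λ` in its second argument acts on `Λ` as its restriction. [folklore] -/
private theorem mulVec_apply_eq_restrict {K : Matrix (Balaban1983to89.Site P j) (Balaban1983to89.Site P j) ℂ}
    (hK0 : ∀ x₁ ∈ Λ, ∀ x₂ ∉ Λ, K x₁ x₂ = 0) (v : Balaban1983to89.Site P j → ℂ) (x : ↥Λ) :
    (K *ᵥ v) x = ((fun x₁ x₂ : ↥Λ => K x₁ x₂) *ᵥ fun x₂ : ↥Λ => v x₂) x := by
  calc (K *ᵥ v) x = ∑ y, K x y * v y := rfl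
    _ = ∑ y ∈ Λ, K x y * v y :=
        (Finset.sum_subset (Finset.subset_univ Λ) fun y _ hy => by rw [hK0 x x.2 y hy, zero_mul]).symm
    _ = ∑ y : ↥Λ, K x y * v y := (Finset.sum_coe_sort Λ (fun y => K x y * v y)).symm
    _ = _ := rfl

/-- **(3.33), SCALAR-FIELD HALF, FOR THE FULL-LATTICE LOCAL KERNEL** — the form in which p29 g34's (3.30) objects plug in BY NAME: `K` = any
kernel on `T₁ × T₁` vanishing off `Λ` in the second argument and equal on `Λ × Λ` to the complex packaging of the local walk sum (p29's
`cLocC Λ (nOp κ c U₁ 1 univ) M ρ`), `corr = K(Q(u₁)ᴴψ)` on `Λ₇` (p29's `corr330 Λ κ c U₁ M ρ ψ`), `φ = phi330 Λ₇ a L φ0 corr` (r18): then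
`∀ x ∈ Λ₇, ‖φ0 x‖ ≤ c·p` under the located inputs and regime inequalities of `small333_scalar_of_regime` (`κ = aL^{−2}`).
[cite: BalabanImbrieJaffe1988, (3.33) p.270] -/
theorem small333_scalar_phi330_full {a L c : ℝ} (haL : 0 ≤ a * L ^ (-(2 : ℤ))) (U : GaugeField P j U1)
    (hΛ : BIJ88NeumannNoZeroModesTorus.IsBlockUnion 1 Λ) {γ₀ c₀ δ₀ : ℝ} (hγ : 0 < γ₀) (hc : 0 ≤ c₀) (hδ : 0 < δ₀)
    (hA : B4.Hyp56 (chartSet Λ) (reOp Λ (nOp (a * L ^ (-(2 : ℤ))) c U 1 univ)) γ₀ c₀ δ₀)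
    (hU : IsUnit (compress Λ (nOp (a * L ^ (-(2 : ℤ))) c U 1 univ))) {M : ℕ} (hM : 5 ≤ M) (hMR : kR P.d 2 γ₀ c₀ δ₀ < M)
    (hMθ : thetaConst P.d 2 γ₀ c₀ δ₀ < M) (hθW : thetaW P.d 2 γ₀ c₀ δ₀ M < 1) (ρ : ℝ)
    (K : Matrix (Balaban1983to89.Site P j) (Balaban1983to89.Site P j) ℂ) (hK0 : ∀ x₁ ∈ Λ, ∀ x₂ ∉ Λ, K x₁ x₂ = 0)
    (hKl : ∀ x₁ x₂ : ↥Λ, K x₁ x₂ =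
      ⟨cLoc (ldist (N := 2) M) ρ (fun ω y₁ y₂ => latticeCw M (chartSet Λ) 2 (reOp Λ (nOp (a * L ^ (-(2 : ℤ))) c U 1 univ)) ω y₁ y₂)
          (idxEquiv Λ (x₁, 0)) (idxEquiv Λ (x₂, 0)),
       cLoc (ldist (N := 2) M) ρ (fun ω y₁ y₂ => latticeCw M (chartSet Λ) 2 (reOp Λ (nOp (a * L ^ (-(2 : ℤ))) c U 1 univ)) ω y₁ y₂)
          (idxEquiv Λ (x₁, 1)) (idxEquiv Λ (x₂, 0))⟩)
    {φ φ0 corr : Balaban1983to89.Site P j → ℂ} {ψ : Balaban1983to89.Site P (j + 1) → ℂ} {Λ₇ : Finset (Balaban1983to89.Site P j)}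
    (h7 : Λ₇ ⊆ Λ) (hφ : φ = BIJ88Sect3Translations.phi330 Λ₇ a L φ0 corr)
    (hcorr : ∀ x ∈ Λ₇, corr x = (K *ᵥ ((qMatT U 1)ᴴ *ᵥ ψ)) x)
    {pD pQ Φ Ψ R p c₁ : ℝ} (hΦ0 : 0 ≤ Φ)
    (hD : ∀ b : PBond P j, (b.src ∈ Λ ∨ b.tgt ∈ Λ) → ‖covD c (cfg U) φ b‖ ≤ pD)
    (hQ : ∀ y : Balaban1983to89.Site P (j + 1), blockK 1 y ⊆ Λ → ‖ψ y - (qMatT U 1 *ᵥ φ) y‖ ≤ pQ)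
    (hΦ : ∀ b : PBond P j, (b.src ∈ Λ → b.tgt ∉ Λ → ‖φ b.tgt‖ ≤ Φ) ∧ (b.tgt ∈ Λ → b.src ∉ Λ → ‖φ b.src‖ ≤ Φ))
    (hΨ : ∀ y : Balaban1983to89.Site P (j + 1), blockK 1 y ⊆ Λ → ‖ψ y‖ ≤ Ψ)
    (hR : ∀ x ∈ Λ₇, ∀ x₂ ∈ Λ, (∃ μ : Fin P.d, x₂.shift μ ∉ Λ ∨ x₂.unshift μ ∉ Λ) → R ≤ B5Ineq137Torus.T P j x x₂)
    (hpD : pD ≤ c₁ * p) (hpQ : pQ ≤ c₁ * p) (hRΦ : Real.exp (-(δ₀ / 16 / M * R)) * Φ ≤ p)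
    (hδΨ : 2 ^ P.d * γ₀⁻¹ * (1 - thetaW P.d 2 γ₀ c₀ δ₀ M)⁻¹ * Real.exp (-(δ₀ / 16 * (ρ - 3))) * Ψ ≤ p) :
    ∀ x ∈ Λ₇, ‖φ0 x‖ ≤
      (2 * (2 ^ P.d * γ₀⁻¹ * (1 - thetaW P.d 2 γ₀ c₀ δ₀ M)⁻¹ * Real.exp (δ₀ / 4)) * latticeConst P.d (δ₀ / 8 / M)
            * (|c| * (2 * P.d) + a * L ^ (-(2 : ℤ)) * ((P.L : ℝ) ^ P.d)⁻¹) * c₁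
        + 2 * (2 ^ P.d * γ₀⁻¹ * (1 - thetaW P.d 2 γ₀ c₀ δ₀ M)⁻¹ * Real.exp (δ₀ / 4)) * latticeConst P.d (δ₀ / 16 / M)
            * (|c| * (2 * P.d) * |c|)
        + a * L ^ (-(2 : ℤ)) * 2 * latticeConst P.d (δ₀ / 16 / M) * ((P.L : ℝ) ^ P.d)⁻¹) * p :=
  small333_scalar_phi330_region haL U hΛ hγ hc hδ hA hU hM hMR hMθ hθW ρ (fun x₁ x₂ : ↥Λ => K x₁ x₂) hKl h7 hφ
    (fun x₂ hx₂ => by rw [hcorr x₂ hx₂, mulVec_apply_eq_restrict hK0]) hΦ0 hD hQ hΦ hΨ hR hpD hpQ hRΦ hδΨ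

end Main

/-! ## §6  The transfer of (3.15) from `u` to the background `u₁ = u·e^{−ie₀A^{(0)}}` (p. 297: *"Using arguments like the ones we used to
bound D_{ū_{k+1}}ψ, we can replace …"*; (3.24)/(3.27)/(3.28): inside `Λ₁* ∩ Λ₄* ∩ Λ₆*`, `u = u′Q^{s*}v = e^{ie₀A^{(0)}}·u₁`) -/

section Transfer

variable {Λ : Finset (Balaban1983to89.Site P j)}

/-- kernel: `|Π_i z_i − 1| ≤ Σ_i |z_i − 1|` for factors of modulus `≤ 1` (p11's private kernel, copied). [folklore] -/
private theorem norm_prod_sub_one_le {ι : Type*} (s : Finset ι) (z : ι → ℂ) (hz : ∀ i ∈ s, ‖z i‖ ≤ 1) :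
    ‖∏ i ∈ s, z i - 1‖ ≤ ∑ i ∈ s, ‖z i - 1‖ := by
  classical
  induction s using Finset.induction_on with
  | empty => simp
  | insert a s ha ih =>
    rw [prod_insert ha, sum_insert ha]
    have hz' : ∀ i ∈ s, ‖z i‖ ≤ 1 := fun i hi => hz i (mem_insert_of_mem hi)
    have e1 : z a * ∏ i ∈ s, z i - 1 = z a * (∏ i ∈ s, z i - 1) + (z a - 1) := by ring
    rw [e1]
    refine (norm_add_le _ _).trans ?_
    rw [norm_mul, add_comm]
    refine add_le_add le_rfl ?_
    calc ‖z a‖ * ‖∏ i ∈ s, z i - 1‖ ≤ 1 * ‖∏ i ∈ s, z i - 1‖ :=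
          mul_le_mul_of_nonneg_right (hz a (mem_insert_self a s)) (norm_nonneg _)
      _ ≤ _ := by rw [one_mul]; exact ih hz'

/-- kernel: `|e^{iθ} − 1| ≤ |θ|`. [folklore] -/
private theorem norm_exp_mul_I_sub_one_le (θ : ℝ) : ‖Complex.exp ((θ : ℂ) * Complex.I) - 1‖ ≤ |θ| := by
  rw [mul_comm]
  have h := Real.norm_exp_I_mul_ofReal_sub_one_le (x := θ)
  rwa [Real.norm_eq_abs] at h

/-- kernel: the bonds of the block contour `Γ_{yx}` lie in the block of `x` (both end-points; standing range).
[cite: BalabanImbrieJaffe1985, (2.4) p.302] -/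
theorem blockOf_legBond (hj : j + 1 ≤ P.m + P.K) (x : Balaban1983to89.Site P j) (μ : Fin P.d) {t : ℕ} (ht : t < inBlock x μ) :
    blockOf (legBond x μ t).src = blockOf x ∧ blockOf (legBond x μ t).tgt = blockOf x := by
  have hL : inBlock x μ < P.L := Nat.mod_lt _ P.L_pos
  refine ⟨blockOf_legSite hj x μ ⟨t, by omega⟩, ?_⟩
  rw [legBond_tgt]
  exact blockOf_legSite hj x μ ⟨t + 1, by omega⟩

/-- **the contour transports of `u` and `u₁ = u·e^{−ie₀A}` differ by `O(e₀|A|)`, LOCATED**: `|u(Γ_{yx}) − u₁(Γ_{yx})| ≤ d(L−1)|e|M` when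
`|A_b| ≤ M` on the bonds INSIDE THE BLOCK of `x` (p11's `norm_holC_sub_holC_uOne_le` with its global hypothesis localized to the contour;
`u(Γ_{yx}) = u₁(Γ_{yx})·Π_{b∈Γ_{yx}}e^{ieA_b}`, p11's `holC_eq_holC_uOne_mul`). [cite: BalabanImbrieJaffe1985, (3.21) p.308] -/
theorem norm_holC_sub_holC_uOne_le_local (hj : j + 1 ≤ P.m + P.K) (U : GaugeField P j U1) (e : ℝ) (A : PBond P j → ℝ) {M : ℝ}
    (hM0 : 0 ≤ M) (x : Balaban1983to89.Site P j)
    (hM : ∀ b : PBond P j, blockOf b.src = blockOf x → blockOf b.tgt = blockOf x → |A b| ≤ M) :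
    ‖holC U x - holC (uOne U e A) x‖ ≤ P.d * (P.L - 1 : ℕ) * (|e| * M) := by
  rw [holC_eq_holC_uOne_mul U e A x, ← mul_sub_one, norm_mul, norm_holC, one_mul]
  have hin : ∀ μ : Fin P.d, ‖∏ t ∈ range (inBlock x μ), Complex.exp ((e * A (legBond x μ t) : ℝ) * Complex.I)‖ ≤ 1 := fun μ => by
    rw [norm_prod, prod_eq_one fun t _ => Complex.norm_exp_ofReal_mul_I _]
  refine (norm_prod_sub_one_le _ _ fun μ _ => hin μ).trans ?_
  refine (sum_le_sum fun μ _ => norm_prod_sub_one_le _ _ fun t _ => (Complex.norm_exp_ofReal_mul_I _).le).trans ?_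
  calc ∑ μ : Fin P.d, ∑ t ∈ range (inBlock x μ), ‖Complex.exp ((e * A (legBond x μ t) : ℝ) * Complex.I) - 1‖
      ≤ ∑ μ : Fin P.d, ∑ t ∈ range (inBlock x μ), |e| * M := by
        refine sum_le_sum fun μ _ => sum_le_sum fun t ht => ?_
        refine (norm_exp_mul_I_sub_one_le _).trans ?_
        rw [abs_mul]
        have hb := blockOf_legBond hj x μ (Finset.mem_range.1 ht)
        exact mul_le_mul_of_nonneg_left (hM _ hb.1 hb.2) (abs_nonneg _)
    _ ≤ ∑ _μ : Fin P.d, ((P.L - 1 : ℕ) : ℝ) * (|e| * M) := by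
        refine sum_le_sum fun μ _ => ?_
        rw [sum_const, card_range, nsmul_eq_mul]
        refine mul_le_mul_of_nonneg_right ?_ (by positivity)
        have : inBlock x μ < P.L := Nat.mod_lt _ P.L_pos
        exact_mod_cast (show inBlock x μ ≤ P.L - 1 by omega)
    _ = _ := by rw [sum_const, card_univ, Fintype.card_fin, nsmul_eq_mul, mul_assoc]

/-- **the block averages of `u` and `u₁` differ by `O(e₀|A|·|φ|)`, LOCATED**: `|(Q(u)φ)(y) − (Q(u₁)φ)(y)| ≤ d(L−1)|e|M·Φ` when `|A_b| ≤ M` on the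
bonds inside `B(y)` and `|φ| ≤ Φ` on `B(y)` (p11's `qCov_sub_qCov_uOne` + the located transport bound; the `L^d` sites against the weight
`L^{−d}`). [cite: BalabanImbrieJaffe1985, (3.25) p.308] -/
theorem norm_qCov_sub_qCov_uOne_le_local (hj : j + 1 ≤ P.m + P.K) (U : GaugeField P j U1) (e : ℝ) (A : PBond P j → ℝ) {M Φ : ℝ}
    (hM0 : 0 ≤ M) (φ : Balaban1983to89.Site P j → ℂ) (y : Balaban1983to89.Site P (j + 1))
    (hM : ∀ b : PBond P j, blockOf b.src = y → blockOf b.tgt = y → |A b| ≤ M) (hΦ : ∀ x ∈ block y, ‖φ x‖ ≤ Φ) :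
    ‖qCov U φ y - qCov (uOne U e A) φ y‖ ≤ P.d * (P.L - 1 : ℕ) * (|e| * M) * Φ := by
  have hN : (0 : ℝ) < (P.L : ℝ) ^ P.d := pow_pos (Nat.cast_pos.2 P.L_pos) _
  rw [qCov_sub_qCov_uOne, norm_mul, norm_inv, norm_pow, Complex.norm_natCast]
  have hsum : ‖∑ x ∈ block y, (holC U x - holC (uOne U e A) x) * φ x‖ ≤ ∑ x ∈ block y, P.d * (P.L - 1 : ℕ) * (|e| * M) * Φ := by
    refine (norm_sum_le _ _).trans (sum_le_sum fun x hx => ?_)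
    rw [norm_mul]
    have hy : blockOf x = y := mem_block_iff.1 hx
    have h1 := norm_holC_sub_holC_uOne_le_local hj U e A hM0 x (fun b hs ht => hM b (hy ▸ hs) (hy ▸ ht))
    have hK : 0 ≤ (P.d : ℝ) * (P.L - 1 : ℕ) * (|e| * M) := by positivity
    exact mul_le_mul h1 (hΦ x hx) (norm_nonneg _) hK
  rw [sum_const, Balaban1983to89.Site.card_block hj y, nsmul_eq_mul, Nat.cast_pow] at hsum
  calc ((P.L : ℝ) ^ P.d)⁻¹ * ‖∑ x ∈ block y, (holC U x - holC (uOne U e A) x) * φ x‖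
      ≤ ((P.L : ℝ) ^ P.d)⁻¹ * ((P.L : ℝ) ^ P.d * (P.d * (P.L - 1 : ℕ) * (|e| * M) * Φ)) :=
        mul_le_mul_of_nonneg_left hsum (by positivity)
    _ = _ := by rw [← mul_assoc, inv_mul_cancel₀ hN.ne', one_mul]

/-- kernel: the matrix `Q(u)` of record acts as r18's one-step average `qCov`. [cite: BalabanImbrieJaffe1985, (2.6) p.303] -/
theorem qMatT_one_mulVec (U : GaugeField P j U1) (φ : Balaban1983to89.Site P j → ℂ) (y : Balaban1983to89.Site P (j + 1)) :
    (qMatT U 1 *ᵥ φ) y = qCov U φ y := by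
  rw [qMatT_mulVec, qCovK_one]

/-- kernel: the sites of the `1`-block `B(y)` (r18's `block y`) are those of p11's `blockK 1 y`. [cite: BalabanImbrieJaffe1985, (2.4) p.302] -/
theorem mem_block_iff_mem_blockK {x : Balaban1983to89.Site P j} {y : Balaban1983to89.Site P (j + 1)} : x ∈ block y ↔ x ∈ blockK 1 y := by
  rw [mem_block_iff, mem_blockK]
  rfl

/-- **(3.15) TRANSFERRED TO THE BACKGROUND `u₁ = u·e^{−ie₀A^{(0)}}`, first clause**: on a bond `b` with `|A^{(0)}_b| ≤ c_Ap`, `|φ(b₊)| ≤ Φ` and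
`|(D_uφ)(b)| ≤ p`: `|(D_{u₁}φ)(b)| ≤ p + |c|·|e₀|c_Ap·Φ` (p11's `norm_covD_sub_covD_uOne_le`: `(D_uφ)_b − (D_{u₁}φ)_b = c(u_b − u₁(b))φ(b₊)`,
`|u_b − u₁(b)| ≤ |e₀A^{(0)}_b|`). [cite: BalabanImbrieJaffe1988, (3.15) p.267] -/
theorem norm_covD_uOne_le {c e₀ cA p Φ : ℝ} (U : GaugeField P j U1) {A0 : PBond P j → ℝ} {φ : Balaban1983to89.Site P j → ℂ}
    {b : PBond P j} (hD : ‖covD c (cfg U) φ b‖ ≤ p) (hA : |A0 b| ≤ cA * p) (hφ : ‖φ b.tgt‖ ≤ Φ) (hp : 0 ≤ p) (hcA : 0 ≤ cA) :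
    ‖covD c (cfg (uOne U e₀ A0)) φ b‖ ≤ p + |c| * (|e₀| * (cA * p)) * Φ := by
  have h1 := norm_covD_sub_covD_uOne_le c e₀ U A0 φ b
  have h2 : |c| * |e₀ * A0 b| * ‖φ b.tgt‖ ≤ |c| * (|e₀| * (cA * p)) * Φ := by
    rw [abs_mul]
    exact mul_le_mul (mul_le_mul_of_nonneg_left (mul_le_mul_of_nonneg_left hA (abs_nonneg _)) (abs_nonneg _)) hφ (norm_nonneg _)
      (by positivity)
  calc ‖covD c (cfg (uOne U e₀ A0)) φ b‖
      ≤ ‖covD c (cfg U) φ b‖ + ‖covD c (cfg U) φ b - covD c (cfg (uOne U e₀ A0)) φ b‖ := by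
        rw [← norm_neg (covD c (cfg U) φ b - _)]
        exact (norm_add_le _ _).trans' (by rw [neg_sub, add_sub_cancel])
    _ ≤ p + |c| * (|e₀| * (cA * p)) * Φ := add_le_add hD (h1.trans h2)

/-- **(3.15) TRANSFERRED TO THE BACKGROUND `u₁`, second clause**: on a block `B(y)` with `|A^{(0)}| ≤ c_Ap` on its bonds, `|φ| ≤ Φ` on its sites
and `|ψ(y) − (Q(u)φ)(y)| ≤ p`: `|ψ(y) − (Q(u₁)φ)(y)| ≤ p + d(L−1)|e₀|c_Ap·Φ`. [cite: BalabanImbrieJaffe1988, (3.15) p.267] -/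
theorem norm_sub_qMatT_uOne_le (hj : j + 1 ≤ P.m + P.K) {e₀ cA p Φ : ℝ} (U : GaugeField P j U1) {A0 : PBond P j → ℝ}
    {φ : Balaban1983to89.Site P j → ℂ} {ψ : Balaban1983to89.Site P (j + 1) → ℂ} {y : Balaban1983to89.Site P (j + 1)}
    (hQ : ‖ψ y - (qMatT U 1 *ᵥ φ) y‖ ≤ p) (hA : ∀ b : PBond P j, blockOf b.src = y → blockOf b.tgt = y → |A0 b| ≤ cA * p)
    (hφ : ∀ x ∈ block y, ‖φ x‖ ≤ Φ) (hp : 0 ≤ p) (hcA : 0 ≤ cA) :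
    ‖ψ y - (qMatT (uOne U e₀ A0) 1 *ᵥ φ) y‖ ≤ p + P.d * (P.L - 1 : ℕ) * (|e₀| * (cA * p)) * Φ := by
  have h1 := norm_qCov_sub_qCov_uOne_le_local hj U e₀ A0 (by positivity : 0 ≤ cA * p) φ y hA hφ
  rw [qMatT_one_mulVec] at hQ ⊢
  calc ‖ψ y - qCov (uOne U e₀ A0) φ y‖ = ‖(ψ y - qCov U φ y) + (qCov U φ y - qCov (uOne U e₀ A0) φ y)‖ := by rw [sub_add_sub_cancel]
    _ ≤ _ := (norm_add_le _ _).trans (add_le_add hQ h1)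

/-- **(3.33), SCALAR-FIELD HALF, FROM (3.15) AS PRINTED (AT `u`) + THE GAUGE HALF `|A^{(0)}| ≦ c_Ap(e₀)`**, the background being
`u₁ = u·e^{−ie₀A^{(0)}}` = p11's `uOne u e₀ A^{(0)}` ((3.24)/(3.27)/(3.28): inside `Λ₁* ∩ Λ₄* ∩ Λ₆*` the translated field is `u = e^{ie₀A^{(0)}}u₁`;
gen 39's `BIJ88Small333GaugeField.small333_gauge` bounds `A^{(0)}` on `Λ₁*`): r18's `SmallField315` AT `u` on a region `Λ₀` containing `Λ` and its
outer layer, `|A^{(0)}_b| ≤ c_Ap(e₀)` on the bonds of `Λ₀`, r18's `SmallBlock332` for `|ψ| ≦ c′p(e₀)λ₀^{−1/4}` on the blocks of `Λ`, and the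
extra REGIME inequality `|e₀|c_Ap(e₀)λ₀^{−1/4} ≤ 1` (the transfer costs `e₀c_Ap·λ₀^{−1/4}p` per bond) ⟹ on `Λ₇ ⊆ Λ` (margin `R`)
**`‖φ^{(0)}(x)‖ ≤ c·p(e₀)`** with `c₁ = 1 + |c| + d(L−1)` in the constant of `small333_scalar_of_regime`.
[cite: BalabanImbrieJaffe1988, (3.33) p.270] -/
theorem small333_scalar_of_smallField315_at_u (hj : j + 1 ≤ P.m + P.K) {a L c e₀ cA : ℝ} (haL : 0 ≤ a * L ^ (-(2 : ℤ))) (hcA : 0 ≤ cA)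
    (U : GaugeField P j U1) (A0 : PBond P j → ℝ) (hΛ : BIJ88NeumannNoZeroModesTorus.IsBlockUnion 1 Λ) {γ₀ c₀ δ₀ : ℝ} (hγ : 0 < γ₀)
    (hc : 0 ≤ c₀) (hδ : 0 < δ₀) (hA : B4.Hyp56 (chartSet Λ) (reOp Λ (nOp (a * L ^ (-(2 : ℤ))) c (uOne U e₀ A0) 1 univ)) γ₀ c₀ δ₀)
    (hU : IsUnit (compress Λ (nOp (a * L ^ (-(2 : ℤ))) c (uOne U e₀ A0) 1 univ))) {M : ℕ} (hM : 5 ≤ M) (hMR : kR P.d 2 γ₀ c₀ δ₀ < M)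
    (hMθ : thetaConst P.d 2 γ₀ c₀ δ₀ < M) (hθW : thetaW P.d 2 γ₀ c₀ δ₀ M < 1) (ρ : ℝ)
    (K : Matrix (Balaban1983to89.Site P j) (Balaban1983to89.Site P j) ℂ) (hK0 : ∀ x₁ ∈ Λ, ∀ x₂ ∉ Λ, K x₁ x₂ = 0)
    (hKl : ∀ x₁ x₂ : ↥Λ, K x₁ x₂ =
      ⟨cLoc (ldist (N := 2) M) ρ (fun ω y₁ y₂ => latticeCw M (chartSet Λ) 2 (reOp Λ (nOp (a * L ^ (-(2 : ℤ))) c (uOne U e₀ A0) 1 univ)) ω y₁ y₂)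
          (idxEquiv Λ (x₁, 0)) (idxEquiv Λ (x₂, 0)),
       cLoc (ldist (N := 2) M) ρ (fun ω y₁ y₂ => latticeCw M (chartSet Λ) 2 (reOp Λ (nOp (a * L ^ (-(2 : ℤ))) c (uOne U e₀ A0) 1 univ)) ω y₁ y₂)
          (idxEquiv Λ (x₁, 1)) (idxEquiv Λ (x₂, 0))⟩)
    {φ φ0 corr : Balaban1983to89.Site P j → ℂ} {ψ : Balaban1983to89.Site P (j + 1) → ℂ} {Λ₇ : Finset (Balaban1983to89.Site P j)}
    (h7 : Λ₇ ⊆ Λ) (hφ : φ = BIJ88Sect3Translations.phi330 Λ₇ a L φ0 corr)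
    (hcorr : ∀ x ∈ Λ₇, corr x = (K *ᵥ ((qMatT (uOne U e₀ A0) 1)ᴴ *ᵥ ψ)) x)
    {Λ₀ : Finset (Balaban1983to89.Site P j)} {Λ₀' : Finset (Balaban1983to89.Site P (j + 1))} {pe₀ lam₀ c' e₀' R : ℝ} (hpe : 0 ≤ pe₀)
    (hlam : 0 ≤ lam₀) {f0 : Balaban1983to89.Plaq P j → ℝ} {v : Balaban1983to89.Plaq P (j + 1) → ℂ} {Dψ : PBond P (j + 1) → ℂ}
    (h315 : BIJ88Sect3Statements.SmallField315 pe₀ lam₀ Λ₀ Λ₀' (covD c (cfg U) φ) ψ (qMatT U 1 *ᵥ φ) φ f0)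
    (h332 : BIJ88Sect3Statements.SmallBlock332 c' e₀' pe₀ lam₀ Λ₀' v ψ Dψ)
    (hA0 : ∀ b ∈ BIJ88Sect3Statements.starB Λ₀, |A0 b| ≤ cA * pe₀)
    (hB : ∀ b : PBond P j, (b.src ∈ Λ ∨ b.tgt ∈ Λ) → b ∈ BIJ88Sect3Statements.starB Λ₀)
    (hY : ∀ y : Balaban1983to89.Site P (j + 1), blockK 1 y ⊆ Λ → y ∈ Λ₀')
    (hR : ∀ x ∈ Λ₇, ∀ x₂ ∈ Λ, (∃ μ : Fin P.d, x₂.shift μ ∉ Λ ∨ x₂.unshift μ ∉ Λ) → R ≤ B5Ineq137Torus.T P j x x₂)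
    (hRlam : Real.exp (-(δ₀ / 16 / M * R)) * lam₀ ^ (-(1 / 4 : ℝ)) ≤ 1)
    (hδlam : 2 ^ P.d * γ₀⁻¹ * (1 - thetaW P.d 2 γ₀ c₀ δ₀ M)⁻¹ * Real.exp (-(δ₀ / 16 * (ρ - 3))) * (c' * lam₀ ^ (-(1 / 4 : ℝ))) ≤ 1)
    (helam : |e₀| * (cA * pe₀) * lam₀ ^ (-(1 / 4 : ℝ)) ≤ 1) :
    ∀ x ∈ Λ₇, ‖φ0 x‖ ≤
      (2 * (2 ^ P.d * γ₀⁻¹ * (1 - thetaW P.d 2 γ₀ c₀ δ₀ M)⁻¹ * Real.exp (δ₀ / 4)) * latticeConst P.d (δ₀ / 8 / M)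
            * (|c| * (2 * P.d) + a * L ^ (-(2 : ℤ)) * ((P.L : ℝ) ^ P.d)⁻¹) * (1 + |c| + P.d * (P.L - 1 : ℕ))
        + 2 * (2 ^ P.d * γ₀⁻¹ * (1 - thetaW P.d 2 γ₀ c₀ δ₀ M)⁻¹ * Real.exp (δ₀ / 4)) * latticeConst P.d (δ₀ / 16 / M)
            * (|c| * (2 * P.d) * |c|)
        + a * L ^ (-(2 : ℤ)) * 2 * latticeConst P.d (δ₀ / 16 / M) * ((P.L : ℝ) ^ P.d)⁻¹) * pe₀ := by
  obtain ⟨hD0, hQ0, hφ0, -⟩ := h315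
  obtain ⟨-, hψ0, -⟩ := h332
  have hlq : 0 ≤ lam₀ ^ (-(1 / 4 : ℝ)) := Real.rpow_nonneg hlam _
  -- sites of Λ, of its outer layer and of its blocks lie in Λ₀
  have hΛ0 : ∀ x ∈ Λ, x ∈ Λ₀ := fun x hx =>
    ((BIJ88Sect3Statements.mem_starB _ _).1 (hB ⟨x, ⟨0, P.hd⟩⟩ (Or.inl hx))).1
  have hout : ∀ b : PBond P j, (b.src ∈ Λ → b.tgt ∉ Λ → ‖φ b.tgt‖ ≤ lam₀ ^ (-(1 / 4 : ℝ)) * pe₀) ∧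
      (b.tgt ∈ Λ → b.src ∉ Λ → ‖φ b.src‖ ≤ lam₀ ^ (-(1 / 4 : ℝ)) * pe₀) := fun b =>
    ⟨fun hs _ => hφ0 _ ((BIJ88Sect3Statements.mem_starB _ _).1 (hB b (Or.inl hs))).2,
     fun ht _ => hφ0 _ ((BIJ88Sect3Statements.mem_starB _ _).1 (hB b (Or.inr ht))).1⟩
  -- the transfer error per bond / per block, in units of pe₀
  have herr : |e₀| * (cA * pe₀) * (lam₀ ^ (-(1 / 4 : ℝ)) * pe₀) ≤ pe₀ := by
    calc |e₀| * (cA * pe₀) * (lam₀ ^ (-(1 / 4 : ℝ)) * pe₀) = (|e₀| * (cA * pe₀) * lam₀ ^ (-(1 / 4 : ℝ))) * pe₀ := by ring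
      _ ≤ 1 * pe₀ := mul_le_mul_of_nonneg_right helam hpe
      _ = pe₀ := one_mul _
  -- (3.15) at u₁, first clause
  have hD1 : ∀ b : PBond P j, (b.src ∈ Λ ∨ b.tgt ∈ Λ) → ‖covD c (cfg (uOne U e₀ A0)) φ b‖ ≤ (1 + |c|) * pe₀ := by
    intro b hb
    have hb0 := hB b hb
    have htgt : b.tgt ∈ Λ₀ := ((BIJ88Sect3Statements.mem_starB _ _).1 hb0).2
    have h := norm_covD_uOne_le (e₀ := e₀) U (hD0 b hb0) (hA0 b hb0) (hφ0 _ htgt) hpe hcA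
    calc _ ≤ pe₀ + |c| * (|e₀| * (cA * pe₀)) * (lam₀ ^ (-(1 / 4 : ℝ)) * pe₀) := h
      _ = pe₀ + |c| * (|e₀| * (cA * pe₀) * (lam₀ ^ (-(1 / 4 : ℝ)) * pe₀)) := by ring
      _ ≤ pe₀ + |c| * pe₀ := add_le_add le_rfl (mul_le_mul_of_nonneg_left herr (abs_nonneg c))
      _ = (1 + |c|) * pe₀ := by ring
  -- (3.15) at u₁, second clause
  have hQ1 : ∀ y : Balaban1983to89.Site P (j + 1), blockK 1 y ⊆ Λ →
      ‖ψ y - (qMatT (uOne U e₀ A0) 1 *ᵥ φ) y‖ ≤ (1 + P.d * (P.L - 1 : ℕ)) * pe₀ := by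
    intro y hy
    have hAy : ∀ b : PBond P j, blockOf b.src = y → blockOf b.tgt = y → |A0 b| ≤ cA * pe₀ := fun b hs _ =>
      hA0 b (hB b (Or.inl (hy (mem_blockK.2 hs))))
    have hφy : ∀ x ∈ block y, ‖φ x‖ ≤ lam₀ ^ (-(1 / 4 : ℝ)) * pe₀ := fun x hx =>
      hφ0 x (hΛ0 x (hy (mem_block_iff_mem_blockK.1 hx)))
    have h := norm_sub_qMatT_uOne_le hj (e₀ := e₀) U (hQ0 y (hY y hy)) hAy hφy hpe hcA
    calc _ ≤ pe₀ + P.d * (P.L - 1 : ℕ) * (|e₀| * (cA * pe₀)) * (lam₀ ^ (-(1 / 4 : ℝ)) * pe₀) := h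
      _ = pe₀ + P.d * (P.L - 1 : ℕ) * (|e₀| * (cA * pe₀) * (lam₀ ^ (-(1 / 4 : ℝ)) * pe₀)) := by ring
      _ ≤ pe₀ + P.d * (P.L - 1 : ℕ) * pe₀ := add_le_add le_rfl (mul_le_mul_of_nonneg_left herr (by positivity))
      _ = (1 + P.d * (P.L - 1 : ℕ)) * pe₀ := by ring
  refine small333_scalar_phi330_full haL (uOne U e₀ A0) hΛ hγ hc hδ hA hU hM hMR hMθ hθW ρ K hK0 hKl h7 hφ hcorr (by positivity)
    hD1 hQ1 hout (fun y hy => hψ0 y (hY y hy)) hR ?_ ?_ ?_ ?_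
  · have h0 : (0 : ℝ) ≤ P.d * (P.L - 1 : ℕ) := by positivity
    exact mul_le_mul_of_nonneg_right (by linarith) hpe
  · have h0 : (0 : ℝ) ≤ |c| := abs_nonneg c
    exact mul_le_mul_of_nonneg_right (by linarith) hpe
  · calc Real.exp (-(δ₀ / 16 / M * R)) * (lam₀ ^ (-(1 / 4 : ℝ)) * pe₀)
        = Real.exp (-(δ₀ / 16 / M * R)) * lam₀ ^ (-(1 / 4 : ℝ)) * pe₀ := by ring
      _ ≤ 1 * pe₀ := mul_le_mul_of_nonneg_right hRlam hpe
      _ = pe₀ := one_mul _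
  · calc 2 ^ P.d * γ₀⁻¹ * (1 - thetaW P.d 2 γ₀ c₀ δ₀ M)⁻¹ * Real.exp (-(δ₀ / 16 * (ρ - 3))) * (c' * pe₀ * lam₀ ^ (-(1 / 4 : ℝ)))
        = 2 ^ P.d * γ₀⁻¹ * (1 - thetaW P.d 2 γ₀ c₀ δ₀ M)⁻¹ * Real.exp (-(δ₀ / 16 * (ρ - 3))) * (c' * lam₀ ^ (-(1 / 4 : ℝ))) * pe₀ := by
          ring
      _ ≤ 1 * pe₀ := mul_le_mul_of_nonneg_right hδlam hpe
      _ = pe₀ := one_mul _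

end Transfer

/-! ## 7. The located margin from the collar (r18's `collarShrink`) -/

section Collar

variable {P : Params} {j : ℕ} {Λ : Finset (Balaban1983to89.Site P j)}

/-- **THE LOCATED MARGIN FROM THE COLLAR** (print p. 267: the regions `Λ_α^{(0)}` are *"obtained from Λ_0^{(0)} … by deleting r(e₀)-cubes at
the boundary"*; p. 274: *"subtracting collar neighborhoods of width r(e_j)"* = r18's `BIJ88RegionTower274.collarShrink`): if `Λ₇` lies in
`Λ` minus its collar of width `R`, then every site of `Λ` with a lattice neighbour outside `Λ` is at sup torus distance `≥ R`
(`B5Ineq137Torus.T` = `supDist`, `B3Bound323ZeroTorus.T_eq_supDist`) from every `x ∈ Λ₇` — the margin hypothesis `hR` of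
`small333_scalar_phi330_region` / `_full` / `_of_smallField315`, DISCHARGED. [cite: BalabanImbrieJaffe1988, (3.33) p.270] -/
theorem margin_of_subset_collarShrink {R : ℕ} {Λ₇ : Finset (Balaban1983to89.Site P j)} (h7 : Λ₇ ⊆ collarShrink R Λ) :
    ∀ x ∈ Λ₇, ∀ x₂ ∈ Λ, (∃ μ : Fin P.d, x₂.shift μ ∉ Λ ∨ x₂.unshift μ ∉ Λ) → (R : ℝ) ≤ B5Ineq137Torus.T P j x x₂ := by
  intro x hx x₂ _ hμ
  obtain ⟨μ, hμ⟩ := hμ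
  have hfar := (mem_collarShrink.1 (h7 hx)).2
  rw [T_eq_supDist]
  have key : ∀ y, y ∉ Λ → supDist x y ≤ supDist x x₂ + 1 → R ≤ supDist x x₂ := fun y hy hle => by
    have h := hfar y hy
    omega
  exact_mod_cast hμ.elim (fun h => key _ h (supDist_shift_le_succ x x₂ μ)) fun h => key _ h (supDist_unshift_le_succ x x₂ μ)

/-- **(3.33), SCALAR-FIELD HALF, ON THE COLLAR-SHRUNK REGION** — `small333_scalar_phi330_full` with the located margin read through r18's
`collarShrink` BY NAME: `Λ₇ ⊆ collarShrink R Λ` (the sites of `Λ` more than `R` from `Λᶜ`, print's *"deleting r(e₀)-cubes at the boundary"*)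
replaces the pointwise margin hypothesis. [cite: BalabanImbrieJaffe1988, (3.33) p.270] -/
theorem small333_scalar_phi330_collar {a L c : ℝ} (haL : 0 ≤ a * L ^ (-(2 : ℤ))) (U : GaugeField P j U1)
    (hΛ : BIJ88NeumannNoZeroModesTorus.IsBlockUnion 1 Λ) {γ₀ c₀ δ₀ : ℝ} (hγ : 0 < γ₀) (hc : 0 ≤ c₀) (hδ : 0 < δ₀)
    (hA : B4.Hyp56 (chartSet Λ) (reOp Λ (nOp (a * L ^ (-(2 : ℤ))) c U 1 univ)) γ₀ c₀ δ₀)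
    (hU : IsUnit (compress Λ (nOp (a * L ^ (-(2 : ℤ))) c U 1 univ))) {M : ℕ} (hM : 5 ≤ M) (hMR : kR P.d 2 γ₀ c₀ δ₀ < M)
    (hMθ : thetaConst P.d 2 γ₀ c₀ δ₀ < M) (hθW : thetaW P.d 2 γ₀ c₀ δ₀ M < 1) (ρ : ℝ)
    (K : Matrix (Balaban1983to89.Site P j) (Balaban1983to89.Site P j) ℂ) (hK0 : ∀ x₁ ∈ Λ, ∀ x₂ ∉ Λ, K x₁ x₂ = 0)
    (hKl : ∀ x₁ x₂ : ↥Λ, K x₁ x₂ =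
      ⟨cLoc (ldist (N := 2) M) ρ (fun ω y₁ y₂ => latticeCw M (chartSet Λ) 2 (reOp Λ (nOp (a * L ^ (-(2 : ℤ))) c U 1 univ)) ω y₁ y₂)
          (idxEquiv Λ (x₁, 0)) (idxEquiv Λ (x₂, 0)),
       cLoc (ldist (N := 2) M) ρ (fun ω y₁ y₂ => latticeCw M (chartSet Λ) 2 (reOp Λ (nOp (a * L ^ (-(2 : ℤ))) c U 1 univ)) ω y₁ y₂)
          (idxEquiv Λ (x₁, 1)) (idxEquiv Λ (x₂, 0))⟩)
    {φ φ0 corr : Balaban1983to89.Site P j → ℂ} {ψ : Balaban1983to89.Site P (j + 1) → ℂ} {Λ₇ : Finset (Balaban1983to89.Site P j)}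
    {R : ℕ} (h7 : Λ₇ ⊆ collarShrink R Λ) (hφ : φ = BIJ88Sect3Translations.phi330 Λ₇ a L φ0 corr)
    (hcorr : ∀ x ∈ Λ₇, corr x = (K *ᵥ ((qMatT U 1)ᴴ *ᵥ ψ)) x)
    {pD pQ Φ Ψ p c₁ : ℝ} (hΦ0 : 0 ≤ Φ)
    (hD : ∀ b : PBond P j, (b.src ∈ Λ ∨ b.tgt ∈ Λ) → ‖covD c (cfg U) φ b‖ ≤ pD)
    (hQ : ∀ y : Balaban1983to89.Site P (j + 1), blockK 1 y ⊆ Λ → ‖ψ y - (qMatT U 1 *ᵥ φ) y‖ ≤ pQ)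
    (hΦ : ∀ b : PBond P j, (b.src ∈ Λ → b.tgt ∉ Λ → ‖φ b.tgt‖ ≤ Φ) ∧ (b.tgt ∈ Λ → b.src ∉ Λ → ‖φ b.src‖ ≤ Φ))
    (hΨ : ∀ y : Balaban1983to89.Site P (j + 1), blockK 1 y ⊆ Λ → ‖ψ y‖ ≤ Ψ)
    (hpD : pD ≤ c₁ * p) (hpQ : pQ ≤ c₁ * p) (hRΦ : Real.exp (-(δ₀ / 16 / M * R)) * Φ ≤ p)
    (hδΨ : 2 ^ P.d * γ₀⁻¹ * (1 - thetaW P.d 2 γ₀ c₀ δ₀ M)⁻¹ * Real.exp (-(δ₀ / 16 * (ρ - 3))) * Ψ ≤ p) :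
    ∀ x ∈ Λ₇, ‖φ0 x‖ ≤
      (2 * (2 ^ P.d * γ₀⁻¹ * (1 - thetaW P.d 2 γ₀ c₀ δ₀ M)⁻¹ * Real.exp (δ₀ / 4)) * latticeConst P.d (δ₀ / 8 / M)
            * (|c| * (2 * P.d) + a * L ^ (-(2 : ℤ)) * ((P.L : ℝ) ^ P.d)⁻¹) * c₁
        + 2 * (2 ^ P.d * γ₀⁻¹ * (1 - thetaW P.d 2 γ₀ c₀ δ₀ M)⁻¹ * Real.exp (δ₀ / 4)) * latticeConst P.d (δ₀ / 16 / M)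
            * (|c| * (2 * P.d) * |c|)
        + a * L ^ (-(2 : ℤ)) * 2 * latticeConst P.d (δ₀ / 16 / M) * ((P.L : ℝ) ^ P.d)⁻¹) * p :=
  small333_scalar_phi330_full haL U hΛ hγ hc hδ hA hU hM hMR hMθ hθW ρ K hK0 hKl (h7.trans (collarShrink_subset R Λ)) hφ hcorr hΦ0 hD hQ
    hΦ hΨ (margin_of_subset_collarShrink h7) hpD hpQ hRΦ hδΨ

end Collar

end

end Literature.MathematicalPhysics.QuantumFieldTheory.BalabanImbrieJaffe1984to88.BIJ88Small333ScalarField
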